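import Mathlib
import Literature.NumberTheory.LFunctions.Zhang2022.Section7bStatements
import Literature.NumberTheory.LFunctions.Zhang2022.KappaLSeries
import Literature.NumberTheory.LFunctions.Zhang2022.Section5Lemma53
import Literature.NumberTheory.GaussSums.AdditiveCharacterExpansion
import HarnessLib

/-!
# Zhang (2022), §7 part (b) — DISCHARGES of `Section7bStatements` claims and kernel edges
# `(7.7)′ ⇒ (7.8) ⇒ (7.9)`, `(7.6) ∧ (7.9) ∧ (7.10) ∧ (7.11) ⇒ Proposition 7.1`

Topic `Literature/NumberTheory/LFunctions/Zhang2022` (Landau–Siegel audit tree; verdict-neutral).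
Y. Zhang, *Discrete mean estimates and the Landau–Siegel zero*, arXiv:2211.02515v1 (2022)
[Zhang2022LandauSiegel] — an unrefereed manuscript under adjudication (cell siegel-zhang, D-0069;
seat L2-t3). This THEOREM-ONLY companion of `Section7bStatements` (same namespace; no definitions,
no new facts) PROVES, for the claims typed there from §7 pp. 35–37 (tex L1912–L1982):

* `step7u026_holds` — `Z22:§7.u026`, "`k̄/p ≡ −p̄/k + 1/(pk) (mod 1)`" (Chinese remainder theorem);
* `step7u027_holds` — `Z22:§7.u027`, "`e(lk̄/p)Δ₁(l/pk) = e(−lp̄/k)Δ(l/pk)`" ((5.7) + u026);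
* `step7u028_holds` — `Z22:§7.u028`, "`e(−lp̄/k) = μ(k)/φ(k) + φ(k)⁻¹Σ′_θ τ(θ̄)θ(l)θ̄(−p)`" — the
  tree's `Literature.NumberTheory.GaussSums.stdAddChar_neg_mul_inv_eq` (orthogonality of
  characters, the campaign FACT-LIST's F-11, with the Ramanujan-sum principal term `τ(θ̄₀) = μ(k)`,
  F-07), transported to this file's `e(x) = exp{2πix}` / `nonprincTwist`;
* `step7u025_holds` — `Z22:§7.u025`, "`Σ*_ψ τ(ψ̄)ψ(l)ψ̄(k) = pe(lk̄/p) + O(1)`" with `O(1) = 2` — the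
  tree's `Literature.NumberTheory.GaussSums.norm_sum_nontrivial_sub_le` (F-07/F-11; for a prime
  modulus the primitive characters are the non-principal ones and `τ(ψ⁰_p) = −1`), transported to
  `tauTwist` (a sum over the members of `Ψ = Skeleton.Chr D` with modulus `p`);
* `step7t1972_holds` — the sentence "`(pt₀)^{β₃} = −1 + O(α₁)`" (tex L1972) under the reading
  `α₁ := α𝓛` of the undefined `α₁`, with `C = 3(520 + 2π|c′|)` for `D ≥ e³` — so the reading suffices;
* `dedProp71red_holds` — the reduction sentence tex L1972: **Proposition 7.1 (`Skeleton.Prop71 c′`)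
  follows from (7.6), (7.9), the `(pt₀)^{β₃}`-evaluation, (7.10) and (7.11)** — pure bookkeeping
  (`Σ_{p∼P} p = 𝔓`, `#{p∼P}·P ≤ 𝔓`, `|(pt₀)^{β₃}| = 1`, `#{p∼P}·PT^{−c} ≤ T^{−c}𝔓 = o(𝔓)`);
* the kernel edges `eq78_of_step7t1944 : Step7t1944 c′ → Eq78 c′` ((7.7) without `(l,p)=1` ⇒
  (7.8), termwise by u027, `(k,p) = 1` as `k < PT⁻² < p`) and `eq79_of_eq78 : Eq78 c′ → Eq79 c′`
  ("inserting" u028 into (7.8); the `l`-series converge absolutely by Lemma 5.3 (5.9), a THEOREM of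
  the tree, `Skeleton.lemma53_holds`, via `summable_mul_DeltaW`: `|(κ∗a₁)(n)| ≤ Bn⁴`
  (`norm_kappaConv_le`, from `|κ(n)| ≤ n³`) and both exponentials of (5.9) are `≤ x⁻⁶` for large `x`;
  the node `Skeleton.Lemma53` enters as a hypothesis — discharge it with `Skeleton.lemma53_holds`);
* the conv-seam bridge `kappaConv_eq_conv` (`kappaConv c′ D a = MeanSquareMajorant.conv κ a`);
* the kernel edge `step7u023_of_step7u022 : Skeleton.Lemma53 → Step7u022 c′ → Step7u023 c′`
  (`Z22:§7.u022 ⇒ Z22:§7.u023`, "This yields": summing the term-by-term formula over the `≤ p`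
  primitive `ψ (mod p)`, exchanging `Σ*_ψ` with the absolutely convergent `m`-series —
  `sum_I1termwise_eq_rhs7u023`, `summable_mul_of_decay`, `|Δ₁| = |Δ|` — and absorbing
  `p·Ce^{−c𝓛¹⁰} ≤ |C|e^{−(c/2)𝓛¹⁰}`).
* the kernel edge `step7u024_of_lemma53 : Skeleton.Lemma53 → Step7u024 c′` (`Z22:§7.u024`, "On
  substituting `d = (m,n)`, `m = dl`, `n = dk`": the rearrangement `rhs7u023 = rhs7u024` is EXACT —
  `rhs7u023_eq_rhs7u024`: for each `m` the finite `n`-sum is re-indexed by the bijection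
  `n ↦ ((m,n), n/(m,n))`, the `l`-series by `l ↦ dl` (`Function.Injective.tsum_eq`), and the finite
  `d`-sum is exchanged with the absolutely convergent `m`-series; `ψ(dl)ψ̄(dk) = ψ(l)ψ̄(k)` as
  `d < PT⁻² < p`, `tauTwist_mul_left`), and the composite `sumPrimAt_I1psi_sub_rhs7u024`
  (`Σ*_ψ I₁(ψ) = rhs7u024 + O(ε)` from Lemma 5.3 and §7.u022).
* UNCONDITIONAL forms, feeding the tree's theorem `Skeleton.lemma53_holds` (module
  `Section5Lemma53`) to the `Lemma53` hypothesis: **`step7u024_holds : Step7u024 c′`** (the node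
  `Z22:§7.u024` DISCHARGED outright), `eq79_of_eq78' : Eq78 c′ → Eq79 c′`,
  `step7u023_of_step7u022' : Step7u022 c′ → Step7u023 c′`, `sumPrimAt_I1psi_sub_rhs7u024'`.
* the single entry point **`prop71_of_leaves : Eq76 c′ → Step7t1944 c′ → Eq710 c′ → Eq711 c′ →
  Skeleton.Prop71 c′`** — Proposition 7.1 from its four remaining analytic leaves (7.6), (7.7)′,
  (7.10), (7.11) (the `(pt₀)^{β₃}` sentence, (7.8), (7.9) and Lemma 5.3 being theorems of the tree),
  and `ded71_of_leaves` (the same four leaves imply the skeleton's proof node `Skeleton.Ded71 c′`);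
* for the (7.7) discharger: `tauTwist_eq` (`Z22:§7.u025` EXACT: `Σ* = (p−1)e(lk̄/p) + 1` for
  `(kl,p) = 1`) and `tauTwist_eq_zero_of_dvd` (`Σ* = 0` for `p ∣ l` — the origin of `(l,p) = 1`).
* the reductions of `Z22:(7.7)` and of the sentence tex L1944 to EXPLICIT error sums:
  `rhs7u024_eq_rhs77_add` (`rhs7u024 = rhs77 + p⁻¹E₇₇`, `E₇₇` = the `(1 − e(lk̄/p))`-weighted sum),
  `rhs77all_eq_rhs77_add` (`rhs77all = rhs77 + F₇₇`, `F₇₇` = the `p ∣ l` terms), and the kernel edges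
  `eq77_of : Step7u022 c′ → (p⁻¹E₇₇ = O(PT⁻ᶜ)) → Eq77 c′`,
  `step7t1944_of : Eq77 c′ → (F₇₇ = O(PT⁻ᶜ)) → Step7t1944 c′` (with `exp_neg_ell_ten_le_bigP_mul_bigT_rpow`:
  `e^{−c₁𝓛¹⁰} ≤ PT^{−c}` for `c ≤ c₁`).

After this file, the last step of `Skeleton.Ded71` rests on the four leaves (7.6) (`Eq76`), (7.8)
(`Eq78`, or (7.7)′ `Step7t1944`), (7.10) (`Eq710`), (7.11) (`Eq711`). Nothing here asserts or
denies Theorems 1–2 of the manuscript.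

## References

* Y. Zhang, arXiv:2211.02515v1 (2022), §7 pp. 35–37, tex L1912–L1982; §5 Lemma 5.3 (5.9) p. 25.
  [cite: Zhang2022LandauSiegel, §7 (7.6)–(7.11) pp. 35–37]
* H. L. Montgomery, R. C. Vaughan, *Multiplicative Number Theory I* (2007), §4.3 (orthogonality),
  §9.2 Thm 9.5 (Gauss sums) — via the tree's `Literature.NumberTheory.GaussSums.*`.
  [cite: MontgomeryVaughan2007, Thm 9.5]
-/

noncomputable section

open Complex Real

namespace Literature.NumberTheory.LFunctions.Zhang2022.Section7bStatements

/-! ## Discharges (theorem-only append) -/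

/-- **`Z22:§7.u026` holds**: `k̄/p ≡ −p̄/k + 1/(pk) (mod 1)` — by the Chinese remainder theorem,
`kk̄ + pp̄ − 1` is divisible by `p` and by `k`, hence by `pk`. [cite: Zhang2022LandauSiegel, §7 p. 36, tex L1945] -/
theorem step7u026_holds : Step7u026 := by
  intro p k hp hk hcop
  haveI : NeZero p := ⟨hp.ne'⟩
  haveI : NeZero k := ⟨hk.ne'⟩
  set K : ℕ := ((k : ZMod p)⁻¹).val with hK
  set Q : ℕ := ((p : ZMod k)⁻¹).val with hQ
  have hdivp : (p : ℤ) ∣ ((k : ℤ) * K + (p : ℤ) * Q - 1) := by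
    refine (ZMod.intCast_zmod_eq_zero_iff_dvd _ p).mp ?_
    have h1 : ((k : ZMod p) * (K : ZMod p)) = 1 := by
      rw [hK, ZMod.natCast_zmod_val]; exact ZMod.coe_mul_inv_eq_one k hcop
    push_cast
    rw [ZMod.natCast_self, zero_mul, add_zero, h1, sub_self]
  have hdivk : (k : ℤ) ∣ ((k : ℤ) * K + (p : ℤ) * Q - 1) := by
    refine (ZMod.intCast_zmod_eq_zero_iff_dvd _ k).mp ?_
    have h1 : ((p : ZMod k) * (Q : ZMod k)) = 1 := by
      rw [hQ, ZMod.natCast_zmod_val]; exact ZMod.coe_mul_inv_eq_one p hcop.symm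
    push_cast
    rw [ZMod.natCast_self, zero_mul, zero_add, h1, sub_self]
  have hcopZ : IsCoprime (p : ℤ) (k : ℤ) := Nat.isCoprime_iff_coprime.mpr hcop.symm
  obtain ⟨z, hz⟩ := hcopZ.mul_dvd hdivp hdivk
  refine ⟨z, ?_⟩
  have hp' : (p : ℝ) ≠ 0 := by exact_mod_cast hp.ne'
  have hk' : (k : ℝ) ≠ 0 := by exact_mod_cast hk.ne'
  have hzR : (k : ℝ) * K + (p : ℝ) * Q - 1 = (p : ℝ) * k * z := by exact_mod_cast hz
  field_simp
  linear_combination hzR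

/-- **`Z22:§7.u027` holds**: `e(lk̄/p)Δ₁(l/(pk)) = e(−lp̄/k)Δ(l/(pk))`, from (5.7) `Δ = Δ₁·e` (the tree's
`Lemma53.Delta57`) and the mod-1 relation `Z22:§7.u026`. [cite: Zhang2022LandauSiegel, §7 p. 36, tex L1949] -/
theorem step7u027_holds : Step7u027 := by
  intro D p k l hp hk hcop
  obtain ⟨z, hz⟩ := step7u026_holds p k hp hk hcop
  have hp' : (p : ℂ) ≠ 0 := by exact_mod_cast hp.ne'
  have hk' : (k : ℂ) ≠ 0 := by exact_mod_cast hk.ne'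
  have hzC : ((((k : ZMod p)⁻¹).val : ℂ) / (p : ℂ)) =
      -((((p : ZMod k)⁻¹).val : ℂ) / (k : ℂ)) + 1 / ((p : ℂ) * k) + (z : ℂ) := by
    have h := congrArg (fun r : ℝ => (r : ℂ)) hz
    push_cast at h
    exact h
  simp only [Skeleton.DeltaW, Lemma53.Delta57, Iface.Delta1W]
  have key : Complex.exp (2 * π * I * ((l : ℂ) * (((k : ZMod p)⁻¹).val : ℂ) / (p : ℂ))) =
      Complex.exp (2 * π * I * (-((l : ℂ) * (((p : ZMod k)⁻¹).val : ℂ) / (k : ℂ)))) *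
        Complex.exp (2 * π * I * (((l : ℝ) / ((p : ℝ) * k) : ℝ) : ℂ)) := by
    rw [← Complex.exp_add]
    have hre : 2 * π * I * ((l : ℂ) * (((k : ZMod p)⁻¹).val : ℂ) / (p : ℂ)) =
        2 * π * I * (-((l : ℂ) * (((p : ZMod k)⁻¹).val : ℂ) / (k : ℂ))) +
          2 * π * I * (((l : ℝ) / ((p : ℝ) * k) : ℝ) : ℂ) + ((l * z : ℤ) : ℂ) * (2 * π * I) := by
      have e1 : (l : ℂ) * (((k : ZMod p)⁻¹).val : ℂ) / (p : ℂ) =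
          (l : ℂ) * ((((k : ZMod p)⁻¹).val : ℂ) / (p : ℂ)) := by ring
      rw [e1, hzC]
      push_cast
      ring
    rw [hre, Complex.exp_add, Complex.exp_int_mul_two_pi_mul_I, mul_one]
  rw [key]
  push_cast
  ring

/-- Unfolding of `nonprincTwist` at a non-zero modulus: the printed `Σ′_{θ (mod k)}` as a sum over
`Finset.univ.erase 1`. [cite: Zhang2022LandauSiegel, §7 p. 36, tex L1957] -/
theorem nonprincTwist_eq_sum_erase (l p k : ℕ) [NeZero k] :
    nonprincTwist l p k = ∑ θ ∈ (Finset.univ : Finset (DirichletCharacter ℂ k)).erase 1,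
      GammaFactor.tau θ⁻¹ * θ (l : ZMod k) * θ⁻¹ (-(p : ZMod k)) := by
  classical
  obtain ⟨k', hk'⟩ : ∃ k', k = k' + 1 := ⟨k - 1, by have := NeZero.pos k; omega⟩
  subst hk'
  simp only [nonprincTwist]
  rw [Finset.filter_ne']

/-- **`Z22:§7.u028` holds** (exactly): `e(−lp̄/k) = μ(k)/φ(k) + φ(k)⁻¹Σ′_{θ (mod k)} τ(θ̄)θ(l)θ̄(−p)` for
`(l,k) = (p,k) = 1` — the tree's `Literature.NumberTheory.GaussSums.stdAddChar_neg_mul_inv_eq`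
(orthogonality of characters, FACT-LIST F-11, with the principal term `τ(θ̄₀) = μ(k)`, F-07, split
off), transported to this file's `e(x) = exp{2πix}` and `nonprincTwist`.
[cite: Zhang2022LandauSiegel, §7 p. 36, tex L1957] -/
theorem step7u028_holds : Step7u028 := by
  intro k p l hk hl hp
  haveI : NeZero k := ⟨hk.ne'⟩
  classical
  set lU : (ZMod k)ˣ := ZMod.unitOfCoprime l hl with hlU
  set pU : (ZMod k)ˣ := ZMod.unitOfCoprime p hp with hpU
  have h := Literature.NumberTheory.GaussSums.stdAddChar_neg_mul_inv_eq (k := k) lU pU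
  have hl' : (lU : ZMod k) = (l : ZMod k) := ZMod.coe_unitOfCoprime l hl
  have hp' : (pU : ZMod k) = (p : ZMod k) := ZMod.coe_unitOfCoprime p hp
  have hpinv : ((pU⁻¹ : (ZMod k)ˣ) : ZMod k) = ((((p : ZMod k)⁻¹).val : ℕ) : ZMod k) := by
    rw [← ZMod.inv_coe_unit, hp', ZMod.natCast_zmod_val]
  rw [hl', hp', hpinv] at h
  have hlhs : (ZMod.stdAddChar (-((l : ZMod k) * ((((p : ZMod k)⁻¹).val : ℕ) : ZMod k))) : ℂ) =
      Complex.exp (2 * π * I * (-((l : ℂ) * (((p : ZMod k)⁻¹).val : ℂ) / (k : ℂ)))) := by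
    have hcast : (-((l : ZMod k) * ((((p : ZMod k)⁻¹).val : ℕ) : ZMod k))) =
        (((-((l : ℤ) * ((((p : ZMod k)⁻¹).val : ℕ) : ℤ))) : ℤ) : ZMod k) := by push_cast; ring
    rw [hcast, ZMod.stdAddChar_coe]
    congr 1
    push_cast
    ring
  rw [hlhs] at h
  rw [h, nonprincTwist_eq_sum_erase, one_div]

/-- For a prime modulus the non-principal characters are primitive (the conductor divides `p` and
is not `1`; "for `p` prime every `χ ≠ χ₀ (mod p)` is primitive", the campaign FACT-LIST's F-11).
[cite: MontgomeryVaughan2007, §9.1] -/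
theorem isPrimitive_of_ne_one_of_prime {p : ℕ} (hp : p.Prime) {ψ : DirichletCharacter ℂ p}
    (hψ : ψ ≠ 1) : ψ.IsPrimitive := by
  haveI : NeZero p := ⟨hp.ne_zero⟩
  rcases (Nat.dvd_prime hp).mp ψ.conductor_dvd_level with h1 | h1
  · exact absurd ((DirichletCharacter.eq_one_iff_conductor_eq_one (χ := ψ)).mpr h1) hψ
  · exact h1

/-- The `Σ*_{ψ (mod p)}` of this file (sum over the members of `Ψ` with modulus `p`) is, for a window
prime `p`, the sum over the non-principal characters mod `p`. [cite: Zhang2022LandauSiegel, §2 p. 3] -/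
theorem sumPrimAt_eq_sum_erase {D p : ℕ} [NeZero p] [DecidableEq (DirichletCharacter ℂ p)]
    (hp : p ∈ Skeleton.primeWindow D)
    (g : DirichletCharacter ℂ p → ℂ) (f : Skeleton.Chr D → ℂ)
    (hfg : ∀ x : Skeleton.Chr D, ∀ hx : x.p = p, f x = g (hx ▸ x.ψ)) :
    sumPrimAt D p f = ∑ ψ ∈ (Finset.univ : Finset (DirichletCharacter ℂ p)).erase 1, g ψ := by
  classical
  have hprime : p.Prime := (Finset.mem_filter.mp hp).2
  have hfin : ({x : Skeleton.Chr D | x.p = p} : Set (Skeleton.Chr D)).Finite := Set.toFinite _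
  rw [sumPrimAt, Skeleton.finsetOf, dif_pos hfin]
  symm
  refine Finset.sum_bij (fun ψ hψ => (⟨p, hp, ψ, isPrimitive_of_ne_one_of_prime hprime
      (Finset.ne_of_mem_erase hψ)⟩ : Skeleton.Chr D)) ?_ ?_ ?_ ?_
  · intro ψ hψ
    simp [Set.Finite.mem_toFinset]
  · intro ψ₁ h₁ ψ₂ h₂ heq
    simp only [Skeleton.Chr.mk.injEq, heq_eq_eq, true_and] at heq
    exact heq
  · rintro ⟨p', mem, ψ, prim⟩ hx
    rw [Set.Finite.mem_toFinset] at hx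
    change p' = p at hx
    subst hx
    refine ⟨ψ, ?_, rfl⟩
    exact Finset.mem_erase.mpr ⟨Skeleton.Chr.ψ_ne_one ⟨p', mem, ψ, prim⟩, Finset.mem_univ _⟩
  · intro ψ hψ
    symm
    exact hfg ⟨p, hp, ψ, isPrimitive_of_ne_one_of_prime hprime (Finset.ne_of_mem_erase hψ)⟩ rfl

/-- **`Z22:§7.u025` holds** with `O(1)` = `2`: for a window prime `p` and `(kl,p) = 1`,
`Σ*_{ψ (mod p)} τ(ψ̄)ψ(l)ψ̄(k) = (p−1)e(lk̄/p) + 1`, so `|Σ* − pe(lk̄/p)| ≤ 2` — the tree's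
`Literature.NumberTheory.GaussSums.norm_sum_nontrivial_sub_le` (Gauss sums and orthogonality,
FACT-LIST F-07/F-11; `τ(ψ⁰_p) = −1`), transported to `tauTwist` and `e(x) = exp{2πix}`.
[cite: Zhang2022LandauSiegel, §7 p. 36, tex L1936] -/
theorem step7u025_holds : Step7u025 := by
  refine ⟨2, fun D p hp k l hkl => ?_⟩
  classical
  have hprime : p.Prime := (Finset.mem_filter.mp hp).2
  haveI : Fact p.Prime := ⟨hprime⟩
  have hk : Nat.Coprime k p := Nat.Coprime.coprime_mul_right hkl
  have hl : Nat.Coprime l p := Nat.Coprime.coprime_mul_left hkl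
  set lU : (ZMod p)ˣ := ZMod.unitOfCoprime l hl with hlU
  set kU : (ZMod p)ˣ := ZMod.unitOfCoprime k hk with hkU
  have h := Literature.NumberTheory.GaussSums.norm_sum_nontrivial_sub_le (p := p) lU kU
  have hl' : (lU : ZMod p) = (l : ZMod p) := ZMod.coe_unitOfCoprime l hl
  have hk' : (kU : ZMod p) = (k : ZMod p) := ZMod.coe_unitOfCoprime k hk
  have hkinv : ((kU⁻¹ : (ZMod p)ˣ) : ZMod p) = ((((k : ZMod p)⁻¹).val : ℕ) : ZMod p) := by
    rw [← ZMod.inv_coe_unit, hk', ZMod.natCast_zmod_val]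
  rw [hl', hk', hkinv] at h
  have hlhs : (ZMod.stdAddChar ((l : ZMod p) * ((((k : ZMod p)⁻¹).val : ℕ) : ZMod p)) : ℂ) =
      Complex.exp (2 * π * I * ((l : ℂ) * (((k : ZMod p)⁻¹).val : ℂ) / (p : ℂ))) := by
    have hcast : ((l : ZMod p) * ((((k : ZMod p)⁻¹).val : ℕ) : ZMod p)) =
        ((((l : ℤ) * ((((k : ZMod p)⁻¹).val : ℕ) : ℤ)) : ℤ) : ZMod p) := by push_cast; ring
    rw [hcast, ZMod.stdAddChar_coe]
    congr 1
    push_cast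
    ring
  rw [hlhs] at h
  have hsum : tauTwist D p l k = ∑ ψ ∈ (Finset.univ : Finset (DirichletCharacter ℂ p)).erase 1,
      gaussSum ψ⁻¹ (ZMod.stdAddChar (N := p)) * ψ (l : ZMod p) * ψ⁻¹ (k : ZMod p) := by
    refine sumPrimAt_eq_sum_erase hp _ _ ?_
    rintro ⟨p', mem, ψ, prim⟩ hx
    change p' = p at hx
    subst hx
    rfl
  rw [hsum]
  exact h

/-- **The sentence tex L1972 holds with `α₁ := α𝓛`**: for `p ∼ P`, `|(pt₀)^{β₃} + 1| ≤ C·α𝓛` with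
`C = 3(520 + 2π|c′|)`, for `D ≥ e³`. Since `β₃ = 3iα(1 − c′α𝓛)` is purely imaginary, `(pt₀)^{β₃} =
e^{iθ}`, `θ = 3α(1 − c′α𝓛)log(pt₀)`, and `θ − 3π = (3π/𝓛⁹)(log p − log P + 519 log 𝓛) − 3c′π²𝓛log(pt₀)/𝓛¹⁸`
with `0 < log p − log P ≤ 𝓛⁻⁶⁸ ≤ 1`, `log(pt₀) ≤ 2𝓛⁹`; the reading `α₁ := α𝓛` of the undefined `α₁`
therefore suffices at this point. [cite: Zhang2022LandauSiegel, §7 p. 37, tex L1972] -/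
theorem step7t1972_holds (c' : ℝ) : Step7t1972 c' := by
  refine ⟨3 * (520 + 2 * π * |c'|), Skeleton.ForAllLarge.of_le ⌈Real.exp 3⌉₊ ?_⟩
  intro D _ χ hD _ _ p hp
  have hL3 : 3 ≤ Skeleton.ell D := by
    have h : Real.exp 3 ≤ D := le_trans (Nat.le_ceil _) (by exact_mod_cast hD)
    exact (Real.le_log_iff_exp_le (lt_of_lt_of_le (Real.exp_pos _) h)).mpr h
  set L := Skeleton.ell D with hLdef
  have hL0 : 0 < L := by linarith
  have hL1 : 1 ≤ L := by linarith
  have hlogP : Real.log (Skeleton.bigP D) = L ^ 9 := by rw [Skeleton.bigP, Real.log_exp]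
  have hα : Skeleton.alpha D = π / L ^ 9 := by rw [Skeleton.alpha, hlogP]
  simp only [Skeleton.primeWindow, Finset.mem_filter, Finset.mem_Ioo] at hp
  obtain ⟨⟨hp1, hp2⟩, -⟩ := hp
  have hPpos : 0 < Skeleton.bigP D := Real.exp_pos _
  have hPp : Skeleton.bigP D < p := (Nat.floor_lt hPpos.le).mp hp1
  have hpU : (p : ℝ) < Skeleton.bigP D * (1 + (L ^ 68)⁻¹) := Nat.lt_ceil.mp hp2
  have hp0 : (0 : ℝ) < p := hPpos.trans hPp
  have ht0 : Skeleton.t0 D = L ^ 519 := rfl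
  have ht0pos : 0 < Skeleton.t0 D := by rw [ht0]; positivity
  have hx0 : 0 < (p : ℝ) * Skeleton.t0 D := mul_pos hp0 ht0pos
  -- bounds for `log p`, `log 𝓛`, `log(pt₀)`
  have hlogp_lo : L ^ 9 < Real.log p := by rw [← hlogP]; exact Real.log_lt_log hPpos hPp
  have hlogp_hi : Real.log p ≤ L ^ 9 + 1 := by
    have h1 : Real.log p < Real.log (Skeleton.bigP D * (1 + (L ^ 68)⁻¹)) :=
      Real.log_lt_log hp0 hpU
    have h2 : Real.log (Skeleton.bigP D * (1 + (L ^ 68)⁻¹)) =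
        L ^ 9 + Real.log (1 + (L ^ 68)⁻¹) := by
      rw [Real.log_mul hPpos.ne' (by positivity), hlogP]
    have h3 : Real.log (1 + (L ^ 68)⁻¹) ≤ (L ^ 68)⁻¹ := by
      have := Real.log_le_sub_one_of_pos (show 0 < 1 + (L ^ 68)⁻¹ by positivity); linarith
    have h4 : (L ^ 68)⁻¹ ≤ 1 := inv_le_one_of_one_le₀ (one_le_pow₀ hL1)
    linarith
  have hlogL0 : 0 ≤ Real.log L := Real.log_nonneg hL1
  have hlogL : Real.log L ≤ L := by have := Real.log_le_sub_one_of_pos hL0; linarith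
  set lx := Real.log ((p : ℝ) * Skeleton.t0 D) with hlxdef
  have hlogx : lx = Real.log p + 519 * Real.log L := by
    rw [hlxdef, Real.log_mul hp0.ne' ht0pos.ne', ht0, Real.log_pow]; push_cast; ring
  have hE : |lx - L ^ 9| ≤ 520 * L := by
    rw [hlogx, abs_le]
    constructor
    · linarith
    · linarith
  have hL8 : (520 : ℝ) ≤ L ^ 8 :=
    le_trans (by norm_num : (520 : ℝ) ≤ 3 ^ 8) (pow_le_pow_left₀ (by norm_num) hL3 8)
  have h520 : 520 * L ≤ L ^ 9 := by
    have := mul_le_mul_of_nonneg_right hL8 hL0.le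
    linarith [this, show L ^ 9 = L ^ 8 * L by ring]
  have hlx_pos : 0 < lx := by linarith [pow_pos hL0 9]
  have hlx_hi : lx ≤ 2 * L ^ 9 := by
    have := (abs_le.mp hE).2
    linarith
  -- the phase
  set θ : ℝ := 3 * Skeleton.alpha D * (1 - c' * Skeleton.alpha D * L) * lx with hθ
  have hθ' : θ - 3 * π = 3 * π / L ^ 9 * (lx - L ^ 9) - c' * (3 * π ^ 2 * L * lx / L ^ 18) := by
    rw [hθ, hα]; field_simp; ring
  have hT1 : |3 * π / L ^ 9 * (lx - L ^ 9)| ≤ 3 * π / L ^ 9 * (520 * L) := by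
    rw [abs_mul, abs_of_pos (by positivity : 0 < 3 * π / L ^ 9)]
    exact mul_le_mul_of_nonneg_left hE (by positivity)
  have hT2 : |c' * (3 * π ^ 2 * L * lx / L ^ 18)| ≤ |c'| * (3 * π ^ 2 * L * (2 * L ^ 9) / L ^ 18) := by
    rw [abs_mul, abs_of_nonneg (by positivity : 0 ≤ 3 * π ^ 2 * L * lx / L ^ 18)]
    refine mul_le_mul_of_nonneg_left ?_ (abs_nonneg _)
    gcongr
  have hbound : |θ - 3 * π| ≤ 3 * (520 + 2 * π * |c'|) * (Skeleton.alpha D * L) := by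
    rw [hθ']
    have hsum := (abs_sub _ _).trans (add_le_add hT1 hT2)
    have hid : 3 * π / L ^ 9 * (520 * L) + |c'| * (3 * π ^ 2 * L * (2 * L ^ 9) / L ^ 18) =
        3 * (520 + 2 * π * |c'|) * (Skeleton.alpha D * L) := by
      rw [hα]; field_simp
    linarith [hsum, hid]
  -- the complex power is `e^{iθ}` and `e^{3πi} = −1`
  have hcpow : (((p : ℝ) * Skeleton.t0 D : ℝ) : ℂ) ^ Skeleton.beta3 c' D = Complex.exp (Complex.I * θ) := by
    rw [Complex.cpow_def_of_ne_zero (by exact_mod_cast hx0.ne'), ← Complex.ofReal_log hx0.le,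
      Skeleton.beta3, hθ, hlxdef]
    congr 1
    push_cast
    ring
  have h3pi : Complex.exp (Complex.I * ((3 * π : ℝ) : ℂ)) = -1 := by
    have : Complex.I * ((3 * π : ℝ) : ℂ) = (3 : ℕ) * (π * Complex.I) := by push_cast; ring
    rw [this, Complex.exp_nat_mul, Complex.exp_pi_mul_I]; norm_num
  rw [hcpow]
  have hsplit : Complex.exp (Complex.I * θ) + 1 =
      -(Complex.exp (Complex.I * ((θ - 3 * π : ℝ) : ℂ)) - 1) := by
    have : Complex.exp (Complex.I * θ) =
        Complex.exp (Complex.I * ((θ - 3 * π : ℝ) : ℂ)) * Complex.exp (Complex.I * ((3 * π : ℝ) : ℂ)) := by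
      rw [← Complex.exp_add]; congr 1; push_cast; ring
    rw [this, h3pi]; ring
  rw [hsplit, norm_neg]
  calc ‖Complex.exp (Complex.I * ((θ - 3 * π : ℝ) : ℂ)) - 1‖ ≤ ‖θ - 3 * π‖ :=
        Real.norm_exp_I_mul_ofReal_sub_one_le
    _ = |θ - 3 * π| := Real.norm_eq_abs _
    _ ≤ 3 * (520 + 2 * π * |c'|) * (Skeleton.alpha D * L) := hbound

variable (c' : ℝ) in
/-- `Step7t1972` — `_holds` alias of `step7t1972_holds` above under the fact's exact name, stated under the
prover's own binders as section variables (appended 2026-08-28, D-0026 bookkeeping: the proof term is the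
existing theorem of this file; no statement, definition or attribute is edited; no new named fact; the
ledger's debt table listed the fact unproved). [cite: Zhang2022LandauSiegel, §7 p. 37, tex L1972] -/
theorem _root_.Literature.NumberTheory.LFunctions.Zhang2022.Section7bStatements.Step7t1972_holds :
    _root_.Literature.NumberTheory.LFunctions.Zhang2022.Section7bStatements.Step7t1972 c' :=
  _root_.Literature.NumberTheory.LFunctions.Zhang2022.Section7bStatements.step7t1972_holds (c' := c')

/-- `Re β₃ = 0`: `β₃ = 3iα(1 − c′α𝓛)` is purely imaginary. [cite: Zhang2022LandauSiegel, §2 (2.13)] -/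
theorem beta3_re (c' : ℝ) (D : ℕ) : (Skeleton.beta3 c' D).re = 0 := by
  simp [Skeleton.beta3, Complex.mul_re, Complex.mul_im]

/-- `|x^{β₃}| = 1` for a positive real base. [folklore] -/
private theorem norm_cpow_beta3 (c' : ℝ) (D : ℕ) {x : ℝ} (hx : 0 < x) :
    ‖((x : ℝ) : ℂ) ^ Skeleton.beta3 c' D‖ = 1 := by
  rw [Complex.norm_cpow_eq_rpow_re_of_pos hx, beta3_re, Real.rpow_zero]

/-- `T^{−c} → 0` along `D → ∞` (`T = exp 𝓛^{1.1}`, `𝓛 = log D`). [folklore] -/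
private theorem tendsto_bigT_rpow_neg {c : ℝ} (hc : 0 < c) :
    Filter.Tendsto (fun D : ℕ => Skeleton.bigT D ^ (-c)) Filter.atTop (nhds 0) := by
  have h11 : (0 : ℝ) < 1.1 := by norm_num
  have h := (tendsto_rpow_neg_atTop hc).comp (Real.tendsto_exp_atTop.comp
    ((tendsto_rpow_atTop h11).comp (Real.tendsto_log_atTop.comp tendsto_natCast_atTop_atTop)))
  refine h.congr fun D => ?_
  simp [Skeleton.bigT, Skeleton.ell, Function.comp]

/-- `#{p ∼ P}·P ≤ 𝔓` (every `p ∼ P` exceeds `P`). [cite: Zhang2022LandauSiegel, §2 (2.9)] -/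
theorem card_mul_bigP_le_frakP (D : ℕ) :
    ((Skeleton.primeWindow D).card : ℝ) * Skeleton.bigP D ≤ frakP D := by
  rw [Skeleton.frakP_eq_sum_primeWindow, ← nsmul_eq_mul, ← Finset.sum_const]
  refine Finset.sum_le_sum fun p hp => ?_
  simp only [Skeleton.primeWindow, Finset.mem_filter, Finset.mem_Ioo] at hp
  exact ((Nat.floor_lt (Real.exp_pos _).le).mp hp.1.1).le

set_option maxHeartbeats 800000 in
/-- **The reduction sentence tex L1972 holds**: Proposition 7.1 follows from (7.6), (7.9), the
evaluation `(pt₀)^{β₃} = −1 + O(α𝓛)`, (7.10) (for `p ∼ P`) and (7.11) — pure bookkeeping: summing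
(7.9)–(7.10) over `p ∼ P` (`Σ_{p∼P} p = 𝔓`, `#{p∼P}·P ≤ 𝔓`, `|(pt₀)^{β₃}| = 1`, `α𝓛 ≤ 1`, `𝓛 ≤ 𝓛²`)
and absorbing `#{p∼P}·PT^{−c} ≤ T^{−c}𝔓 = o(𝔓)`. [cite: Zhang2022LandauSiegel, §7 p. 37, tex L1972] -/
theorem dedProp71red_holds (c' : ℝ) : DedProp71red c' := by
  intro h76 h79 h1972 h710 h711 B ε hε
  obtain ⟨C₀, hC₀⟩ := h1972
  set K₀ := max C₀ 0 with hK₀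
  have hK₀nn : 0 ≤ K₀ := le_max_right _ _
  obtain ⟨c, hc, C₉, h79'⟩ := h79 B
  set K₉ := max C₉ 0 with hK₉
  have hK₉nn : 0 ≤ K₉ := le_max_right _ _
  set ε₂ := ε / (4 * (1 + K₀)) with hε₂
  have hε₂pos : 0 < ε₂ := by positivity
  obtain ⟨C₇, h710'⟩ := h710 B ε₂ hε₂pos
  set K₇ := max C₇ 0 with hK₇
  have hK₇nn : 0 ≤ K₇ := le_max_right _ _
  have h76' := h76 B (ε / 4) (by positivity)
  have h711' := h711 B (ε / 4) (by positivity)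
  -- `K₉ T^{-c} ≤ ε/4` eventually
  obtain ⟨D₁, hD₁⟩ : ∃ D₁ : ℕ, ∀ D ≥ D₁, K₉ * Skeleton.bigT D ^ (-c) ≤ ε / 4 := by
    have hδ : (0 : ℝ) < ε / (4 * (K₉ + 1)) := by positivity
    have hev := (tendsto_bigT_rpow_neg hc).eventually (gt_mem_nhds hδ)
    obtain ⟨D₁, hD₁⟩ := Filter.eventually_atTop.mp hev
    refine ⟨D₁, fun D hD => ?_⟩
    have h1 : Skeleton.bigT D ^ (-c) < ε / (4 * (K₉ + 1)) := hD₁ D hD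
    have h2 : 0 ≤ Skeleton.bigT D ^ (-c) := Real.rpow_nonneg (Real.exp_pos _).le _
    calc K₉ * Skeleton.bigT D ^ (-c) ≤ K₉ * (ε / (4 * (K₉ + 1))) :=
          mul_le_mul_of_nonneg_left h1.le hK₉nn
      _ ≤ ε / 4 := by
          rw [mul_div_assoc']
          rw [div_le_div_iff₀ (by positivity) (by positivity)]
          nlinarith
  refine ⟨K₇ + 2 * K₀ + K₀ * K₇, ?_⟩
  have hall := (((h76'.and h79').and (hC₀.and h710')).and h711').and
    (Skeleton.ForAllLarge.of_le (S := fun D _ _ => max D₁ ⌈Real.exp 3⌉₊ ≤ D) (max D₁ ⌈Real.exp 3⌉₊)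
      (fun D _ _ hD _ _ => hD))
  refine hall.mono ?_
  intro D _ χ _ _ ⟨⟨⟨⟨hA76, hA79⟩, ⟨hA0, hA710⟩⟩, hA711⟩, hD⟩ hA a₁ a₂ ha₁ ha₂
  have hD₁' : D₁ ≤ D := le_trans (le_max_left _ _) hD
  have hD3 : ⌈Real.exp 3⌉₊ ≤ D := le_trans (le_max_right _ _) hD
  -- the parameters
  have hL3 : 3 ≤ Skeleton.ell D := by
    have h : Real.exp 3 ≤ D := le_trans (Nat.le_ceil _) (by exact_mod_cast hD3)
    exact (Real.le_log_iff_exp_le (lt_of_lt_of_le (Real.exp_pos _) h)).mpr h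
  set L := Skeleton.ell D with hLdef
  have hL1 : 1 ≤ L := by linarith
  have hL0 : 0 < L := by linarith
  have hLL : L ≤ L ^ 2 := by nlinarith
  have hlogP : Real.log (Skeleton.bigP D) = L ^ 9 := by rw [Skeleton.bigP, Real.log_exp]
  have hα : Skeleton.alpha D = π / L ^ 9 := by rw [Skeleton.alpha, hlogP]
  set α := Skeleton.alpha D with hαdef
  have hαpos : 0 < α := by rw [hα]; positivity
  have hαL : α * L ≤ 1 := by
    rw [hα]
    have hL8 : π ≤ L ^ 8 := le_trans Real.pi_le_four
      (le_trans (by norm_num : (4 : ℝ) ≤ 3 ^ 8) (pow_le_pow_left₀ (by norm_num) hL3 8))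
    rw [div_mul_eq_mul_div, div_le_one (by positivity)]
    nlinarith [show L ^ 9 = L ^ 8 * L by ring]
  set P := Skeleton.bigP D with hPdef
  have hPpos : 0 < P := Real.exp_pos _
  set W := Skeleton.primeWindow D with hWdef
  set PP := frakP D with hPPdef
  have hNP : (W.card : ℝ) * P ≤ PP := card_mul_bigP_le_frakP D
  have hPPnn : 0 ≤ PP := le_trans (by positivity) hNP
  have ht0pos : 0 < Skeleton.t0 D := by
    show 0 < Skeleton.ell D ^ 519
    positivity
  have hT := hD₁ D hD₁'
  -- abbreviations for the objects
  set S1 := Skeleton.Sj c' D 1 a₁ a₂ with hS1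
  set S2 := Skeleton.Sj c' D 2 a₁ a₂ with hS2
  set S3 := Skeleton.Sj c' D 3 a₁ a₂ with hS3
  set Ssum := ‖S1‖ + ‖S2‖ + ‖S3‖ with hSsum
  have hSsum_nn : 0 ≤ Ssum := by positivity
  have hq : 0 ≤ K₇ * L ^ 2 * Ssum + ε₂ :=
    add_nonneg (mul_nonneg (mul_nonneg hK₇nn (pow_nonneg hL0.le 2)) hSsum_nn) hε₂pos.le
  set Sc : ℂ := 1 / 2 * S1 + 2 * S2 + 3 / 2 * S3 with hSc
  have hSc_le : ‖Sc‖ ≤ 2 * Ssum := by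
    calc ‖Sc‖ ≤ ‖1 / 2 * S1‖ + ‖2 * S2‖ + ‖3 / 2 * S3‖ := by
          calc ‖Sc‖ = ‖(1 / 2 * S1 + 2 * S2) + 3 / 2 * S3‖ := rfl
            _ ≤ ‖1 / 2 * S1 + 2 * S2‖ + ‖3 / 2 * S3‖ := norm_add_le _ _
            _ ≤ ‖1 / 2 * S1‖ + ‖2 * S2‖ + ‖3 / 2 * S3‖ := by
                gcongr; exact norm_add_le _ _
      _ = 1 / 2 * ‖S1‖ + 2 * ‖S2‖ + 3 / 2 * ‖S3‖ := by
          simp only [norm_mul]; norm_num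
      _ ≤ 2 * Ssum := by
          rw [hSsum]; nlinarith [norm_nonneg S1, norm_nonneg S2, norm_nonneg S3]
  set u : ℕ → ℂ := fun p => (((p : ℝ) * Skeleton.t0 D : ℝ) : ℂ) ^ Skeleton.beta3 c' D with hu
  set X : ℕ → ℂ := fun p => sumPrimAt D p (fun x => I1psi c' x a₁ a₂) with hX
  set T11 : ℕ → ℂ := fun p => frakT11 c' D p a₁ a₂ with hT11
  set T12 : ℕ → ℂ := fun p => frakT12 c' D p a₁ a₂ with hT12
  set t0c : ℂ := ((Skeleton.t0 D : ℝ) : ℂ) ^ Skeleton.beta3 c' D with ht0c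
  have ht0c_norm : ‖t0c‖ = 1 := norm_cpow_beta3 c' D ht0pos
  -- the five inputs at this `D`, `χ`, `𝐚₁`, `𝐚₂`
  have i76 : ‖Skeleton.Theta1 c' χ a₁ a₂ - (-I) * ∑ p ∈ W, u p * X p‖ ≤ ε / 4 * PP :=
    hA76 hA a₁ a₂ ha₁ ha₂
  have i79 : ∀ p ∈ W, ‖X p - (T11 p + T12 p)‖ ≤ K₉ * P * Skeleton.bigT D ^ (-c) := by
    intro p hp
    refine le_trans (hA79 hA a₁ a₂ ha₁ ha₂ p hp) ?_
    gcongr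
    · exact Real.rpow_nonneg (Real.exp_pos _).le _
    · exact le_max_left _ _
  have i0 : ∀ p ∈ W, ‖u p + 1‖ ≤ K₀ * (α * L) := by
    intro p hp
    refine le_trans (hA0 p hp) ?_
    exact mul_le_mul_of_nonneg_right (le_max_left _ _) (by positivity)
  have i710 : ∀ p ∈ W, ‖I * T11 p - (p : ℂ) / (α : ℂ) * Sc‖ ≤ K₇ * (P * L ^ 2 * Ssum) + ε₂ * P := by
    intro p hp
    refine le_trans (hA710 hA a₁ a₂ ha₁ ha₂ p hp) ?_
    gcongr
    exact le_max_left _ _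
  have i711 : ‖∑ p ∈ W, (p : ℂ) ^ Skeleton.beta3 c' D * T12 p‖ ≤ ε / 4 * PP :=
    hA711 hA a₁ a₂ ha₁ ha₂
  -- per-p facts
  have hu_norm : ∀ p ∈ W, ‖u p‖ = 1 := by
    intro p hp
    simp only [hWdef, Skeleton.primeWindow, Finset.mem_filter, Finset.mem_Ioo] at hp
    have hp0 : (0 : ℝ) < p := lt_trans hPpos ((Nat.floor_lt hPpos.le).mp hp.1.1)
    exact norm_cpow_beta3 c' D (mul_pos hp0 ht0pos)
  have hu_split : ∀ p ∈ W, u p * T12 p = t0c * ((p : ℂ) ^ Skeleton.beta3 c' D * T12 p) := by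
    intro p hp
    simp only [hu, ht0c]
    rw [Complex.ofReal_mul, Complex.mul_cpow_ofReal_nonneg (Nat.cast_nonneg _) ht0pos.le,
      Complex.ofReal_natCast]
    ring
  -- algebraic decomposition
  have h1 : ∑ p ∈ W, u p * X p = ∑ p ∈ W, u p * (X p - (T11 p + T12 p)) +
      t0c * ∑ p ∈ W, (p : ℂ) ^ Skeleton.beta3 c' D * T12 p +
      ∑ p ∈ W, (u p + 1) * T11 p - ∑ p ∈ W, T11 p := by
    rw [Finset.mul_sum, ← Finset.sum_add_distrib, ← Finset.sum_add_distrib, ← Finset.sum_sub_distrib]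
    refine Finset.sum_congr rfl fun p hp => ?_
    rw [← hu_split p hp]
    ring
  have h3 : Skeleton.mainMV c' D a₁ a₂ = ∑ p ∈ W, (p : ℂ) / (α : ℂ) * Sc := by
    have hPPsum : ((PP : ℝ) : ℂ) = ∑ p ∈ W, (p : ℂ) := by
      rw [hPPdef, Skeleton.frakP_eq_sum_primeWindow]; push_cast; rfl
    simp only [Skeleton.mainMV]
    rw [show ((frakP D : ℝ) : ℂ) = ((PP : ℝ) : ℂ) from rfl, hPPsum, Finset.mul_sum]
    refine Finset.sum_congr rfl fun p hp => ?_
    simp only [hSc, hS1, hS2, hS3, hαdef]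
    ring
  have h4 : ∑ p ∈ W, (I * T11 p - (p : ℂ) / (α : ℂ) * Sc) =
      I * ∑ p ∈ W, T11 p - ∑ p ∈ W, (p : ℂ) / (α : ℂ) * Sc := by
    rw [Finset.sum_sub_distrib, Finset.mul_sum]
  have hdecomp : Skeleton.Theta1 c' χ a₁ a₂ - Skeleton.mainMV c' D a₁ a₂ =
      (Skeleton.Theta1 c' χ a₁ a₂ - (-I) * ∑ p ∈ W, u p * X p) +
      (-I) * ∑ p ∈ W, u p * (X p - (T11 p + T12 p)) +
      (-I) * (t0c * ∑ p ∈ W, (p : ℂ) ^ Skeleton.beta3 c' D * T12 p) +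
      (-I) * ∑ p ∈ W, (u p + 1) * T11 p +
      ∑ p ∈ W, (I * T11 p - (p : ℂ) / (α : ℂ) * Sc) := by
    rw [h4, h3, h1]
    ring
  -- the five norm bounds
  have b2 : ‖(-I) * ∑ p ∈ W, u p * (X p - (T11 p + T12 p))‖ ≤ ε / 4 * PP := by
    rw [norm_mul, norm_neg, Complex.norm_I, one_mul]
    calc ‖∑ p ∈ W, u p * (X p - (T11 p + T12 p))‖
        ≤ ∑ p ∈ W, ‖u p * (X p - (T11 p + T12 p))‖ := norm_sum_le _ _
      _ ≤ ∑ p ∈ W, K₉ * P * Skeleton.bigT D ^ (-c) := by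
          refine Finset.sum_le_sum fun p hp => ?_
          rw [norm_mul, hu_norm p hp, one_mul]
          exact i79 p hp
      _ = (W.card : ℝ) * P * (K₉ * Skeleton.bigT D ^ (-c)) := by
          rw [Finset.sum_const, nsmul_eq_mul]; ring
      _ ≤ PP * (ε / 4) :=
          mul_le_mul hNP hT (mul_nonneg hK₉nn (Real.rpow_nonneg (Real.exp_pos _).le _)) hPPnn
      _ = ε / 4 * PP := by ring
  have b3 : ‖(-I) * (t0c * ∑ p ∈ W, (p : ℂ) ^ Skeleton.beta3 c' D * T12 p)‖ ≤ ε / 4 * PP := by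
    rw [norm_mul, norm_neg, Complex.norm_I, one_mul, norm_mul, ht0c_norm, one_mul]
    exact i711
  have hT11_norm : ∀ p ∈ W, ‖T11 p‖ ≤ (p : ℝ) / α * (2 * Ssum) + (K₇ * (P * L ^ 2 * Ssum) + ε₂ * P) := by
    intro p hp
    have hIT : ‖T11 p‖ = ‖I * T11 p‖ := by rw [norm_mul, Complex.norm_I, one_mul]
    rw [hIT]
    calc ‖I * T11 p‖ = ‖(p : ℂ) / (α : ℂ) * Sc + (I * T11 p - (p : ℂ) / (α : ℂ) * Sc)‖ := by ring_nf
      _ ≤ ‖(p : ℂ) / (α : ℂ) * Sc‖ + ‖I * T11 p - (p : ℂ) / (α : ℂ) * Sc‖ := norm_add_le _ _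
      _ ≤ (p : ℝ) / α * (2 * Ssum) + (K₇ * (P * L ^ 2 * Ssum) + ε₂ * P) := by
          gcongr
          · rw [norm_mul, norm_div, Complex.norm_natCast, Complex.norm_real, Real.norm_of_nonneg hαpos.le]
            exact mul_le_mul_of_nonneg_left hSc_le (by positivity)
          · exact i710 p hp
  have b4 : ‖(-I) * ∑ p ∈ W, (u p + 1) * T11 p‖ ≤ (2 * K₀ + K₀ * K₇) * (PP * L ^ 2 * Ssum) + K₀ * ε₂ * PP := by
    rw [norm_mul, norm_neg, Complex.norm_I, one_mul]
    calc ‖∑ p ∈ W, (u p + 1) * T11 p‖ ≤ ∑ p ∈ W, ‖(u p + 1) * T11 p‖ := norm_sum_le _ _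
      _ ≤ ∑ p ∈ W, K₀ * (α * L) * ((p : ℝ) / α * (2 * Ssum) + (K₇ * (P * L ^ 2 * Ssum) + ε₂ * P)) := by
          refine Finset.sum_le_sum fun p hp => ?_
          rw [norm_mul]
          exact mul_le_mul (i0 p hp) (hT11_norm p hp) (norm_nonneg _) (by positivity)
      _ = 2 * K₀ * L * Ssum * (∑ p ∈ W, (p : ℝ)) +
            K₀ * (α * L) * ((W.card : ℝ) * (K₇ * (P * L ^ 2 * Ssum) + ε₂ * P)) := by
          have hαne : α ≠ 0 := hαpos.ne'
          simp_rw [mul_add]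
          rw [Finset.sum_add_distrib, Finset.sum_const, nsmul_eq_mul, Finset.mul_sum]
          congr 1
          · refine Finset.sum_congr rfl fun p _ => ?_
            field_simp
          · ring
      _ ≤ (2 * K₀ + K₀ * K₇) * (PP * L ^ 2 * Ssum) + K₀ * ε₂ * PP := by
          have hsum : ∑ p ∈ W, (p : ℝ) = PP := by
            rw [hPPdef, hWdef, Skeleton.frakP_eq_sum_primeWindow]
          rw [hsum]
          have hNP' : (W.card : ℝ) * (K₇ * (P * L ^ 2 * Ssum) + ε₂ * P) ≤
              PP * (K₇ * L ^ 2 * Ssum + ε₂) := by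
            calc (W.card : ℝ) * (K₇ * (P * L ^ 2 * Ssum) + ε₂ * P)
                = ((W.card : ℝ) * P) * (K₇ * L ^ 2 * Ssum + ε₂) := by ring
              _ ≤ PP * (K₇ * L ^ 2 * Ssum + ε₂) := mul_le_mul_of_nonneg_right hNP hq
          have hX0 : 0 ≤ (W.card : ℝ) * (K₇ * (P * L ^ 2 * Ssum) + ε₂ * P) :=
            mul_nonneg (Nat.cast_nonneg _) (add_nonneg (mul_nonneg hK₇nn
              (mul_nonneg (mul_nonneg hPpos.le (pow_nonneg hL0.le 2)) hSsum_nn))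
              (mul_nonneg hε₂pos.le hPpos.le))
          have e2 : K₀ * (α * L) * ((W.card : ℝ) * (K₇ * (P * L ^ 2 * Ssum) + ε₂ * P)) ≤
              K₀ * 1 * (PP * (K₇ * L ^ 2 * Ssum + ε₂)) :=
            mul_le_mul (mul_le_mul_of_nonneg_left hαL hK₀nn) hNP' hX0 (by rw [mul_one]; exact hK₀nn)
          have e1 : 2 * K₀ * L * Ssum * PP ≤ 2 * K₀ * L ^ 2 * Ssum * PP := by
            have h0 : 0 ≤ 2 * K₀ * Ssum * PP :=
              mul_nonneg (mul_nonneg (mul_nonneg (by norm_num) hK₀nn) hSsum_nn) hPPnn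
            linarith [mul_le_mul_of_nonneg_left hLL h0]
          linarith [e1, e2]
  have b5 : ‖∑ p ∈ W, (I * T11 p - (p : ℂ) / (α : ℂ) * Sc)‖ ≤ K₇ * (PP * L ^ 2 * Ssum) + ε₂ * PP := by
    calc ‖∑ p ∈ W, (I * T11 p - (p : ℂ) / (α : ℂ) * Sc)‖
        ≤ ∑ p ∈ W, ‖I * T11 p - (p : ℂ) / (α : ℂ) * Sc‖ := norm_sum_le _ _
      _ ≤ ∑ p ∈ W, (K₇ * (P * L ^ 2 * Ssum) + ε₂ * P) := Finset.sum_le_sum i710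
      _ = ((W.card : ℝ) * P) * (K₇ * L ^ 2 * Ssum + ε₂) := by
          rw [Finset.sum_const, nsmul_eq_mul]; ring
      _ ≤ PP * (K₇ * L ^ 2 * Ssum + ε₂) := mul_le_mul_of_nonneg_right hNP hq
      _ = K₇ * (PP * L ^ 2 * Ssum) + ε₂ * PP := by ring
  -- assembly
  have hEcal : Skeleton.Ecal c' D a₁ a₂ = PP * L ^ 2 * Ssum := rfl
  have hε₂id : (1 + K₀) * ε₂ = ε / 4 := by
    rw [hε₂]; field_simp
  rw [hdecomp, hEcal]
  calc ‖(Skeleton.Theta1 c' χ a₁ a₂ - (-I) * ∑ p ∈ W, u p * X p) +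
        (-I) * ∑ p ∈ W, u p * (X p - (T11 p + T12 p)) +
        (-I) * (t0c * ∑ p ∈ W, (p : ℂ) ^ Skeleton.beta3 c' D * T12 p) +
        (-I) * ∑ p ∈ W, (u p + 1) * T11 p +
        ∑ p ∈ W, (I * T11 p - (p : ℂ) / (α : ℂ) * Sc)‖
      ≤ ‖Skeleton.Theta1 c' χ a₁ a₂ - (-I) * ∑ p ∈ W, u p * X p‖ +
        ‖(-I) * ∑ p ∈ W, u p * (X p - (T11 p + T12 p))‖ +
        ‖(-I) * (t0c * ∑ p ∈ W, (p : ℂ) ^ Skeleton.beta3 c' D * T12 p)‖ +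
        ‖(-I) * ∑ p ∈ W, (u p + 1) * T11 p‖ +
        ‖∑ p ∈ W, (I * T11 p - (p : ℂ) / (α : ℂ) * Sc)‖ := by
          refine le_trans (norm_add_le _ _) (add_le_add ?_ le_rfl)
          refine le_trans (norm_add_le _ _) (add_le_add ?_ le_rfl)
          refine le_trans (norm_add_le _ _) (add_le_add ?_ le_rfl)
          exact norm_add_le _ _
    _ ≤ ε / 4 * PP + ε / 4 * PP + ε / 4 * PP +
        ((2 * K₀ + K₀ * K₇) * (PP * L ^ 2 * Ssum) + K₀ * ε₂ * PP) +
        (K₇ * (PP * L ^ 2 * Ssum) + ε₂ * PP) := by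
          gcongr
    _ = (K₇ + 2 * K₀ + K₀ * K₇) * (PP * L ^ 2 * Ssum) + ε * PP := by
          have : ε = 4 * ((1 + K₀) * ε₂) := by rw [hε₂id]; ring
          rw [this]; ring

variable (c' : ℝ) in
/-- `DedProp71red` — `_holds` alias of `dedProp71red_holds` above under the fact's exact name, stated under the
prover's own binders as section variables (appended 2026-08-28, D-0026 bookkeeping: the proof term is the
existing theorem of this file; no statement, definition or attribute is edited; no new named fact; the
ledger's debt table listed the fact unproved). [cite: Zhang2022LandauSiegel, §7 p. 37, tex L1972] -/
theorem _root_.Literature.NumberTheory.LFunctions.Zhang2022.Section7bStatements.DedProp71red_holds :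
    _root_.Literature.NumberTheory.LFunctions.Zhang2022.Section7bStatements.DedProp71red c' :=
  _root_.Literature.NumberTheory.LFunctions.Zhang2022.Section7bStatements.dedProp71red_holds (c' := c')

/-- `T = exp{𝓛^{1.1}} ≥ 1`. [cite: Zhang2022LandauSiegel, §6 p. 30] -/
theorem one_le_bigT (D : ℕ) : 1 ≤ Skeleton.bigT D := by
  rw [Skeleton.bigT]
  refine Real.one_le_exp ?_
  refine Real.rpow_nonneg ?_ _
  rw [Skeleton.ell]
  rcases Nat.eq_zero_or_pos D with h | h
  · simp [h]
  · exact Real.log_nonneg (by exact_mod_cast h)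

/-- The right side of (7.7) with `(l,p) = 1` removed EQUALS the right side of (7.8), term by term, by
`Z22:§7.u027` (`k < PT⁻² < p`, so `(k,p) = 1`). [cite: Zhang2022LandauSiegel, §7 (7.8) p. 36, tex L1953] -/
theorem rhs77all_eq_rhs78 (c' : ℝ) {D p : ℕ} (hp : p ∈ Skeleton.primeWindow D) (a₁ a₂ : ℕ → ℂ) :
    rhs77all c' D p a₁ a₂ = rhs78 c' D p a₁ a₂ := by
  have hp' := hp
  simp only [Skeleton.primeWindow, Finset.mem_filter, Finset.mem_Ioo] at hp'
  have hprime : p.Prime := hp'.2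
  have hPpos : 0 < Skeleton.bigP D := Real.exp_pos _
  have hPp : Skeleton.bigP D < p := (Nat.floor_lt hPpos.le).mp hp'.1.1
  unfold rhs77all rhs78
  refine Finset.sum_congr rfl fun d _ => ?_
  congr 1
  refine tsum_congr fun l => ?_
  refine Finset.sum_congr rfl fun k hk => ?_
  obtain ⟨hk, -⟩ := Finset.mem_filter.mp hk
  rw [Finset.mem_Ico] at hk
  have hkP : (k : ℝ) < Skeleton.bigP D / Skeleton.bigT D ^ 2 := Nat.lt_ceil.mp hk.2
  have hkp : k < p := by
    have h1 : Skeleton.bigP D / Skeleton.bigT D ^ 2 ≤ Skeleton.bigP D :=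
      div_le_self hPpos.le (one_le_pow₀ (one_le_bigT D))
    exact_mod_cast (hkP.trans_le h1).trans hPp
  have hcop : Nat.Coprime k p :=
    (Nat.coprime_of_lt_prime (by omega) hkp hprime).symm
  have key := step7u027_holds D p k l hprime.pos (by omega) hcop
  calc kappaConv c' D a₁ (d * l) * a₂ (d * k) / (k : ℂ) *
        Complex.exp (2 * π * I * ((l : ℂ) * (((k : ZMod p)⁻¹).val : ℂ) / (p : ℂ))) *
        Iface.Delta1W D ((l : ℝ) / ((p : ℝ) * k))
      = kappaConv c' D a₁ (d * l) * a₂ (d * k) / (k : ℂ) *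
        (Complex.exp (2 * π * I * ((l : ℂ) * (((k : ZMod p)⁻¹).val : ℂ) / (p : ℂ))) *
          Iface.Delta1W D ((l : ℝ) / ((p : ℝ) * k))) := by ring
    _ = kappaConv c' D a₁ (d * l) * a₂ (d * k) / (k : ℂ) *
        (Complex.exp (2 * π * I * (-((l : ℂ) * (((p : ZMod k)⁻¹).val : ℂ) / (k : ℂ)))) *
          Skeleton.DeltaW D ((l : ℝ) / ((p : ℝ) * k))) := by rw [key]
    _ = _ := by ring

/-- **Kernel edge `(7.7)′ ⇒ (7.8)`**: the all-`l` form of (7.7) (`Step7t1944`) implies (7.8) with the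
same `c` and implied constant — the step "by the relation `k̄/p ≡ −p̄/k + 1/(pk)` … the right side of
(7.7) is …" is exact. [cite: Zhang2022LandauSiegel, §7 (7.8) p. 36, tex L1944–L1955] -/
theorem eq78_of_step7t1944 (c' : ℝ) (h : Step7t1944 c') : Eq78 c' := by
  intro B
  obtain ⟨c, hc, C, hall⟩ := h B
  refine ⟨c, hc, C, hall.mono fun D _ χ _ _ hD hA a₁ a₂ ha₁ ha₂ p hp => ?_⟩
  rw [← rhs77all_eq_rhs78 c' hp a₁ a₂]
  exact hD hA a₁ a₂ ha₁ ha₂ p hp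

/-! ## Summability of the `l`-series and the kernel edge `(7.8) ⇒ (7.9)` -/

/-- `(κ∗a₁)` (tex L1869–L1871, "regard `a₁` as an arithmetic function") is the tree's
`MeanSquareMajorant.conv κ a₁` (`conv_eq_convolution`) — the conv-seam bridge between this file's
`kappaConv` (Mathlib's `LSeries.convolution`) and the `Section7a/7c/7d` files.
[cite: Zhang2022LandauSiegel, §7 p. 34, tex L1869] -/
theorem kappaConv_eq_conv (c' : ℝ) (D : ℕ) (a₁ : ℕ → ℂ) :
    kappaConv c' D a₁ = MeanSquareMajorant.conv (Skeleton.kappaZ c' D) a₁ := by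
  rw [MeanSquareMajorant.conv_eq_convolution]; rfl

/-- `‖κ(n)‖ ≤ n³` for the `κ` of §7 (`Σκ(n)n^{−s} = ζ(s+β₁)ζ(s+β₂)ζ(s+β₃)/ζ(s)`, tex L1865–L1868;
multiplicative with `‖κ(p^k)‖ ≤ (k+1)³ ≤ p^{3k}`) — a crude form of "`(κ∗a₁)(m) = O(τ₅(m))`".
[cite: Zhang2022LandauSiegel, §7 p. 34, tex L1865] -/
theorem norm_kappaZ_le (c' : ℝ) (D : ℕ) {n : ℕ} (hn : n ≠ 0) :
    ‖Skeleton.kappaZ c' D n‖ ≤ (n : ℝ) ^ 3 := by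
  set κ := Skeleton.kappaZ c' D with hκ
  have hmult : κ.IsMultiplicative := MeanSquareMajorant.isMultiplicative_kappa _ _ _
  have hN : (MeanSquareMajorant.normAF κ).IsMultiplicative :=
    MeanSquareMajorant.isMultiplicative_normAF hmult
  have h1 : ‖κ n‖ = MeanSquareMajorant.normAF κ n := rfl
  rw [h1, ArithmeticFunction.IsMultiplicative.multiplicative_factorization _ hN hn]
  have hn3 : ((n : ℝ)) ^ 3 = n.factorization.prod fun p k => ((p : ℝ) ^ k) ^ 3 := by
    conv_lhs => rw [← Nat.prod_factorization_pow_eq_self hn]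
    rw [Finsupp.prod, Finsupp.prod, Nat.cast_prod, ← Finset.prod_pow]
    simp
  rw [hn3, Finsupp.prod, Finsupp.prod]
  refine Finset.prod_le_prod (fun p _ => by rw [MeanSquareMajorant.normAF_apply]; exact norm_nonneg _)
    fun p hp => ?_
  have hpp : p.Prime := Nat.prime_of_mem_primeFactors (by rwa [Nat.support_factorization] at hp)
  rw [MeanSquareMajorant.normAF_apply]
  calc ‖κ (p ^ n.factorization p)‖ ≤ ((n.factorization p : ℝ) + 1) ^ 3 :=
        MeanSquareMajorant.norm_kappa_prime_pow_le _ _ _ hpp _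
    _ ≤ ((p : ℝ) ^ n.factorization p) ^ 3 := by
        gcongr
        have h2k : (n.factorization p : ℝ) + 1 ≤ (2 : ℝ) ^ n.factorization p := by
          exact_mod_cast Nat.lt_pow_self (by norm_num : 1 < 2)
        have hp2 : (2 : ℝ) ^ n.factorization p ≤ (p : ℝ) ^ n.factorization p :=
          pow_le_pow_left₀ (by norm_num) (by exact_mod_cast hpp.two_le) _
        linarith

/-- **Polynomial bound `|(κ∗a₁)(n)| ≤ B n⁴`** for `‖a₁‖ ≤ B` — a crude form of the source's
"Note that `(κ∗a₁)(m) = O(τ₅(m))`" (tex L1903), all that absolute convergence needs.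
[cite: Zhang2022LandauSiegel, §7 p. 35, tex L1903] -/
theorem norm_kappaConv_le (c' : ℝ) (D : ℕ) {a₁ : ℕ → ℂ} {B : ℝ} (ha : ∀ n, ‖a₁ n‖ ≤ B) (n : ℕ) :
    ‖kappaConv c' D a₁ n‖ ≤ B * (n : ℝ) ^ 4 := by
  have hB : 0 ≤ B := le_trans (norm_nonneg _) (ha 0)
  rw [kappaConv_eq_conv]
  refine le_trans (MeanSquareMajorant.norm_conv_le ha n) (mul_le_mul_of_nonneg_left ?_ hB)
  rw [MeanSquareMajorant.absDivSum_apply]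
  rcases Nat.eq_zero_or_pos n with rfl | hn
  · simp
  calc ∑ d ∈ n.divisors, ‖Skeleton.kappaZ c' D d‖ ≤ ∑ d ∈ n.divisors, (n : ℝ) ^ 3 := by
        refine Finset.sum_le_sum fun d hd => ?_
        have hd0 : d ≠ 0 := (Nat.pos_of_mem_divisors hd).ne'
        have hdn : (d : ℝ) ≤ n := by exact_mod_cast Nat.divisor_le hd
        exact (norm_kappaZ_le c' D hd0).trans (by gcongr)
    _ = (n.divisors.card : ℝ) * (n : ℝ) ^ 3 := by rw [Finset.sum_const, nsmul_eq_mul]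
    _ ≤ (n : ℝ) * (n : ℝ) ^ 3 := by
        gcongr
        exact_mod_cast Nat.card_divisors_le_self n
    _ = (n : ℝ) ^ 4 := by ring

/-- Summability of `l ↦ f(l)Φ(l/q)` for polynomially bounded `f` and any `Φ` obeying the (5.9)-type
bound (used for `Φ = Δ` and `Φ = Δ₁`). [cite: Zhang2022LandauSiegel, §5 (5.9) p. 25] -/
theorem summable_mul_of_decay {Φ : ℝ → ℂ} {C a b T : ℝ} (ha : 0 < a) (hb : 0 < b)
    (hΦ : ∀ x : ℝ, T < x → ‖Φ x‖ ≤
      C * (Real.exp (-(a * Real.log x) ^ 2) + Real.exp (-(x ^ (0.99 : ℝ)) / b)))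
    {q : ℝ} (hq : 0 < q) {f : ℕ → ℂ} {M : ℝ} (hf : ∀ l : ℕ, ‖f l‖ ≤ M * (l : ℝ) ^ 4) :
    Summable (fun l : ℕ => f l * Φ ((l : ℝ) / q)) := by
  have href : Summable (fun l : ℕ => ((l : ℝ)) ^ (-2 : ℝ)) :=
    Real.summable_nat_rpow.mpr (by norm_num)
  refine summable_of_isBigO_nat href ?_
  have hM : 0 ≤ M := by
    have := hf 1; simp at this; exact le_trans (norm_nonneg _) this
  have hx : Filter.Tendsto (fun l : ℕ => (l : ℝ) / q) Filter.atTop Filter.atTop :=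
    tendsto_natCast_atTop_atTop.atTop_div_const hq
  have E1 : ∀ᶠ l : ℕ in Filter.atTop, T < (l : ℝ) / q := hx.eventually_gt_atTop T
  have E2 : ∀ᶠ l : ℕ in Filter.atTop, max 1 (Real.exp (6 / a ^ 2)) ≤ (l : ℝ) / q :=
    hx.eventually_ge_atTop _
  have E3 : ∀ᶠ l : ℕ in Filter.atTop,
      ‖Real.log ((l : ℝ) / q)‖ ≤ 1 / (6 * b) * ‖((l : ℝ) / q) ^ (0.99 : ℝ)‖ :=
    hx.eventually ((isLittleO_log_rpow_atTop (by norm_num : (0 : ℝ) < 0.99)).bound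
      (by positivity))
  have E4 : ∀ᶠ l : ℕ in Filter.atTop, 1 ≤ l := Filter.eventually_ge_atTop 1
  refine Asymptotics.IsBigO.of_bound (M * (2 * |C| * q ^ 6)) ?_
  filter_upwards [E1, E2, E3, E4] with l h1 h2 h3 h4
  set x : ℝ := (l : ℝ) / q with hxdef
  have hl0 : (0 : ℝ) < l := by exact_mod_cast h4
  have hx1 : 1 ≤ x := le_trans (le_max_left _ _) h2
  have hx0 : 0 < x := by linarith
  have hlog0 : 0 ≤ Real.log x := Real.log_nonneg hx1
  have hloga : 6 / a ^ 2 ≤ Real.log x :=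
    (Real.le_log_iff_exp_le hx0).mpr (le_trans (le_max_right _ _) h2)
  have hx6 : Real.exp (-(6 * Real.log x)) = x ^ (-6 : ℝ) := by
    rw [Real.rpow_def_of_pos hx0]; ring_nf
  have b1 : Real.exp (-(a * Real.log x) ^ 2) ≤ Real.exp (-(6 * Real.log x)) := by
    rw [Real.exp_le_exp]
    have h6 : 6 ≤ a ^ 2 * Real.log x := by
      have := (div_le_iff₀ (by positivity : (0 : ℝ) < a ^ 2)).mp hloga
      linarith
    nlinarith [mul_nonneg hlog0 (sub_nonneg.mpr h6)]
  have b2 : Real.exp (-(x ^ (0.99 : ℝ)) / b) ≤ Real.exp (-(6 * Real.log x)) := by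
    rw [Real.exp_le_exp]
    have hpow : 0 < x ^ (0.99 : ℝ) := Real.rpow_pos_of_pos hx0 _
    rw [Real.norm_of_nonneg hlog0, Real.norm_of_nonneg hpow.le] at h3
    have : 6 * Real.log x ≤ x ^ (0.99 : ℝ) / b := by
      rw [le_div_iff₀ hb]
      have := mul_le_mul_of_nonneg_left h3 (by positivity : (0 : ℝ) ≤ 6 * b)
      calc 6 * Real.log x * b = 6 * b * Real.log x := by ring
        _ ≤ 6 * b * (1 / (6 * b) * x ^ (0.99 : ℝ)) := this
        _ = x ^ (0.99 : ℝ) := by field_simp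
    rw [neg_div]
    linarith
  have hΦx : ‖Φ x‖ ≤ 2 * |C| * x ^ (-6 : ℝ) := by
    have hsum_le : Real.exp (-(a * Real.log x) ^ 2) + Real.exp (-(x ^ (0.99 : ℝ)) / b) ≤
        2 * x ^ (-6 : ℝ) := by rw [← hx6]; linarith
    have hsum_nn : 0 ≤ Real.exp (-(a * Real.log x) ^ 2) + Real.exp (-(x ^ (0.99 : ℝ)) / b) := by
      positivity
    calc ‖Φ x‖ ≤ C * _ := hΦ x h1
      _ ≤ |C| * (Real.exp (-(a * Real.log x) ^ 2) + Real.exp (-(x ^ (0.99 : ℝ)) / b)) :=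
          mul_le_mul_of_nonneg_right (le_abs_self C) hsum_nn
      _ ≤ |C| * (2 * x ^ (-6 : ℝ)) := mul_le_mul_of_nonneg_left hsum_le (abs_nonneg C)
      _ = 2 * |C| * x ^ (-6 : ℝ) := by ring
  have hx6' : x ^ (-6 : ℝ) = q ^ 6 * (l : ℝ) ^ (-6 : ℝ) := by
    rw [hxdef, Real.div_rpow hl0.le hq.le, Real.rpow_neg hq.le, div_eq_mul_inv, inv_inv]
    norm_num
    ring
  have hl46 : (l : ℝ) ^ 4 * (l : ℝ) ^ (-6 : ℝ) = (l : ℝ) ^ (-2 : ℝ) := by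
    rw [show ((l : ℝ) ^ 4 : ℝ) = (l : ℝ) ^ (4 : ℝ) by norm_cast, ← Real.rpow_add hl0]
    norm_num
  rw [norm_mul, Real.norm_of_nonneg (Real.rpow_nonneg hl0.le _)]
  calc ‖f l‖ * ‖Φ x‖ ≤ (M * (l : ℝ) ^ 4) * (2 * |C| * x ^ (-6 : ℝ)) :=
        mul_le_mul (hf l) hΦx (norm_nonneg _) (by positivity)
    _ = M * (2 * |C| * q ^ 6) * ((l : ℝ) ^ 4 * (l : ℝ) ^ (-6 : ℝ)) := by rw [hx6']; ring
    _ = M * (2 * |C| * q ^ 6) * (l : ℝ) ^ (-2 : ℝ) := by rw [hl46]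

/-- **Summability of `l ↦ f(l)Δ(l/q)`** for polynomially bounded `f` (`|f(l)| ≤ Ml⁴`), from a
Lemma 5.3 (5.9)-type bound `|Δ(x)| ≤ C(e^{−(a log x)²} + e^{−x^{0.99}/b})` for `x > T`: both
exponentials are `≤ x⁻⁶` for large `x`, so the terms are `O(l⁻²)` (`summable_mul_of_decay`).
[cite: Zhang2022LandauSiegel, §5 (5.9) p. 25] -/
theorem summable_mul_DeltaW {D : ℕ} {C a b T : ℝ} (ha : 0 < a) (hb : 0 < b)
    (hΔ : ∀ x : ℝ, T < x → ‖Skeleton.DeltaW D x‖ ≤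
      C * (Real.exp (-(a * Real.log x) ^ 2) + Real.exp (-(x ^ (0.99 : ℝ)) / b)))
    {q : ℝ} (hq : 0 < q) {f : ℕ → ℂ} {M : ℝ} (hf : ∀ l : ℕ, ‖f l‖ ≤ M * (l : ℝ) ^ 4) :
    Summable (fun l : ℕ => f l * Skeleton.DeltaW D ((l : ℝ) / q)) :=
  summable_mul_of_decay ha hb hΔ hq hf

/-- A crude bound for the character sum of tex L1957–L1958 / `𝒯₁₂`:
`|Σ′_{θ (mod k)} τ(θ̄)θ(l)θ̄(−p)| ≤ #{θ mod k}·k`, uniform in `l` (`|τ(θ̄)| ≤ k`, `|θ| ≤ 1`).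
[cite: Zhang2022LandauSiegel, §7 p. 36, tex L1957] -/
theorem norm_nonprincTwist_le (l p k : ℕ) [NeZero k] :
    ‖nonprincTwist l p k‖ ≤ ((Finset.univ : Finset (DirichletCharacter ℂ k)).card : ℝ) * k := by
  classical
  rw [nonprincTwist_eq_sum_erase]
  calc ‖∑ θ ∈ (Finset.univ : Finset (DirichletCharacter ℂ k)).erase 1,
          GammaFactor.tau θ⁻¹ * θ (l : ZMod k) * θ⁻¹ (-(p : ZMod k))‖
      ≤ ∑ θ ∈ (Finset.univ : Finset (DirichletCharacter ℂ k)).erase 1,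
          ‖GammaFactor.tau θ⁻¹ * θ (l : ZMod k) * θ⁻¹ (-(p : ZMod k))‖ := norm_sum_le _ _
    _ ≤ ∑ θ ∈ (Finset.univ : Finset (DirichletCharacter ℂ k)).erase 1, (k : ℝ) := by
        refine Finset.sum_le_sum fun θ _ => ?_
        have h1 : ‖GammaFactor.tau θ⁻¹‖ ≤ k := by
          show ‖gaussSum θ⁻¹ (ZMod.stdAddChar (N := k))‖ ≤ k
          rw [gaussSum]
          calc ‖∑ a : ZMod k, θ⁻¹ a * ZMod.stdAddChar a‖
              ≤ ∑ a : ZMod k, ‖θ⁻¹ a * ZMod.stdAddChar a‖ := norm_sum_le _ _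
            _ ≤ ∑ a : ZMod k, (1 : ℝ) := Finset.sum_le_sum fun a _ => by
                rw [norm_mul, AddChar.norm_apply, mul_one]
                exact DirichletCharacter.norm_le_one _ _
            _ = k := by simp
        have h2 : ‖θ (l : ZMod k)‖ ≤ 1 := DirichletCharacter.norm_le_one _ _
        have h3 : ‖θ⁻¹ (-(p : ZMod k))‖ ≤ 1 := DirichletCharacter.norm_le_one _ _
        rw [norm_mul, norm_mul]
        calc ‖GammaFactor.tau θ⁻¹‖ * ‖θ (l : ZMod k)‖ * ‖θ⁻¹ (-(p : ZMod k))‖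
            ≤ k * 1 * 1 := by
              refine mul_le_mul (mul_le_mul h1 h2 (norm_nonneg _) (Nat.cast_nonneg _)) h3
                (norm_nonneg _) (by positivity)
          _ = k := by ring
    _ ≤ ((Finset.univ : Finset (DirichletCharacter ℂ k)).card : ℝ) * k := by
        rw [Finset.sum_const, nsmul_eq_mul]
        gcongr
        exact Finset.erase_subset (1 : DirichletCharacter ℂ k) Finset.univ

/-- Summability of the generic `l`-series `Σ_l (κ∗a₁)(dl)·g(l)·Δ(l/(pk))` with `g` bounded, from the
(5.9)-type bound for `Δ`. [cite: Zhang2022LandauSiegel, §7 p. 37 (𝒯₁₁, 𝒯₁₂)] -/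
theorem summable_kappaConv_mul_DeltaW {D : ℕ} {C a b T : ℝ} (ha : 0 < a) (hb : 0 < b)
    (hΔ : ∀ x : ℝ, T < x → ‖Skeleton.DeltaW D x‖ ≤
      C * (Real.exp (-(a * Real.log x) ^ 2) + Real.exp (-(x ^ (0.99 : ℝ)) / b)))
    (c' : ℝ) {a₁ : ℕ → ℂ} {B : ℝ} (ha₁ : ∀ n, ‖a₁ n‖ ≤ B) (d : ℕ) {p k : ℕ} (hp0 : 0 < p)
    (hk0 : 0 < k) (g : ℕ → ℂ) {G : ℝ} (hg : ∀ l, ‖g l‖ ≤ G) :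
    Summable (fun l : ℕ =>
      kappaConv c' D a₁ (d * l) * g l * Skeleton.DeltaW D ((l : ℝ) / ((p : ℝ) * k))) := by
  have hB : 0 ≤ B := le_trans (norm_nonneg _) (ha₁ 0)
  have hG : 0 ≤ G := le_trans (norm_nonneg _) (hg 0)
  have hq : (0 : ℝ) < (p : ℝ) * k := by positivity
  refine summable_mul_DeltaW (f := fun l => kappaConv c' D a₁ (d * l) * g l)
    (M := B * (d : ℝ) ^ 4 * G) ha hb hΔ hq fun l => ?_
  rw [norm_mul]
  calc ‖kappaConv c' D a₁ (d * l)‖ * ‖g l‖ ≤ (B * ((d * l : ℕ) : ℝ) ^ 4) * G :=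
        mul_le_mul (norm_kappaConv_le c' D ha₁ _) (hg l) (norm_nonneg _) (by positivity)
    _ = B * (d : ℝ) ^ 4 * G * (l : ℝ) ^ 4 := by push_cast; ring

/-- **The right side of (7.8) equals `𝒯₁₁(p) + 𝒯₁₂(p)`** — "Inserting this into (7.8)" — once the
`l`-series converge (they do, absolutely, by Lemma 5.3 (5.9)): termwise `Z22:§7.u028` with
`(l,k) = 1` (the constraint) and `(p,k) = 1` (`k < PT⁻² < p`).
[cite: Zhang2022LandauSiegel, §7 (7.9) p. 36, tex L1959–L1970] -/
theorem rhs78_eq_frakT11_add_frakT12 (c' : ℝ) {D p : ℕ} (hp : p ∈ Skeleton.primeWindow D)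
    {a₁ a₂ : ℕ → ℂ} {B : ℝ} (ha₁ : ∀ n, ‖a₁ n‖ ≤ B) {C a b T : ℝ} (ha : 0 < a) (hb : 0 < b)
    (hΔ : ∀ x : ℝ, T < x → ‖Skeleton.DeltaW D x‖ ≤
      C * (Real.exp (-(a * Real.log x) ^ 2) + Real.exp (-(x ^ (0.99 : ℝ)) / b))) :
    rhs78 c' D p a₁ a₂ = frakT11 c' D p a₁ a₂ + frakT12 c' D p a₁ a₂ := by
  classical
  have hp' := hp
  simp only [Skeleton.primeWindow, Finset.mem_filter, Finset.mem_Ioo] at hp'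
  have hprime : p.Prime := hp'.2
  have hPpos : 0 < Skeleton.bigP D := Real.exp_pos _
  have hPp : Skeleton.bigP D < p := (Nat.floor_lt hPpos.le).mp hp'.1.1
  have hkp : ∀ k ∈ Finset.Ico 1 (Skeleton.Nsupp D), k < p := by
    intro k hk
    rw [Finset.mem_Ico] at hk
    have hkP : (k : ℝ) < Skeleton.bigP D / Skeleton.bigT D ^ 2 := Nat.lt_ceil.mp hk.2
    have h1 : Skeleton.bigP D / Skeleton.bigT D ^ 2 ≤ Skeleton.bigP D :=
      div_le_self hPpos.le (one_le_pow₀ (one_le_bigT D))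
    exact_mod_cast (hkP.trans_le h1).trans hPp
  unfold rhs78 frakT11 frakT12
  rw [← Finset.sum_add_distrib]
  refine Finset.sum_congr rfl fun d _ => ?_
  rw [← mul_add]
  congr 1
  -- the two `l`-series converge absolutely
  have hS1 : Summable (fun l : ℕ => ∑ k ∈ (Finset.Ico 1 (Skeleton.Nsupp D)).filter
      (fun k => Nat.Coprime k l), kappaConv c' D a₁ (d * l) * a₂ (d * k) *
        (ArithmeticFunction.moebius k : ℂ) / ((k : ℂ) * (Nat.totient k : ℂ)) *
        Skeleton.DeltaW D ((l : ℝ) / ((p : ℝ) * k))) := by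
    have hfun : (fun l : ℕ => ∑ k ∈ (Finset.Ico 1 (Skeleton.Nsupp D)).filter
        (fun k => Nat.Coprime k l), kappaConv c' D a₁ (d * l) * a₂ (d * k) *
          (ArithmeticFunction.moebius k : ℂ) / ((k : ℂ) * (Nat.totient k : ℂ)) *
          Skeleton.DeltaW D ((l : ℝ) / ((p : ℝ) * k))) =
        fun l : ℕ => ∑ k ∈ Finset.Ico 1 (Skeleton.Nsupp D), if Nat.Coprime k l then
          kappaConv c' D a₁ (d * l) * a₂ (d * k) *
          (ArithmeticFunction.moebius k : ℂ) / ((k : ℂ) * (Nat.totient k : ℂ)) *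
          Skeleton.DeltaW D ((l : ℝ) / ((p : ℝ) * k)) else 0 := by
      funext l; rw [Finset.sum_filter]
    rw [hfun]
    refine summable_sum fun k hk => ?_
    have hk1 : 0 < k := by rw [Finset.mem_Ico] at hk; omega
    have hbase := summable_kappaConv_mul_DeltaW ha hb hΔ c' ha₁ d hprime.pos hk1
      (fun _ => a₂ (d * k) * (ArithmeticFunction.moebius k : ℂ) / ((k : ℂ) * (Nat.totient k : ℂ)))
      (fun _ => le_rfl)
    refine Summable.of_norm_bounded hbase.norm fun l => ?_
    split_ifs with h
    · apply le_of_eq; congr 1; ring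
    · rw [norm_zero]; exact norm_nonneg _
  have hS2 : Summable (fun l : ℕ => ∑ k ∈ (Finset.Ico 1 (Skeleton.Nsupp D)).filter
      (fun k => Nat.Coprime k l), kappaConv c' D a₁ (d * l) * a₂ (d * k) /
        ((k : ℂ) * (Nat.totient k : ℂ)) * nonprincTwist l p k *
        Skeleton.DeltaW D ((l : ℝ) / ((p : ℝ) * k))) := by
    have hfun : (fun l : ℕ => ∑ k ∈ (Finset.Ico 1 (Skeleton.Nsupp D)).filter
        (fun k => Nat.Coprime k l), kappaConv c' D a₁ (d * l) * a₂ (d * k) /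
          ((k : ℂ) * (Nat.totient k : ℂ)) * nonprincTwist l p k *
          Skeleton.DeltaW D ((l : ℝ) / ((p : ℝ) * k))) =
        fun l : ℕ => ∑ k ∈ Finset.Ico 1 (Skeleton.Nsupp D), if Nat.Coprime k l then
          kappaConv c' D a₁ (d * l) * a₂ (d * k) /
          ((k : ℂ) * (Nat.totient k : ℂ)) * nonprincTwist l p k *
          Skeleton.DeltaW D ((l : ℝ) / ((p : ℝ) * k)) else 0 := by
      funext l; rw [Finset.sum_filter]
    rw [hfun]
    refine summable_sum fun k hk => ?_
    have hk1 : 0 < k := by rw [Finset.mem_Ico] at hk; omega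
    haveI : NeZero k := ⟨hk1.ne'⟩
    have hbase := summable_kappaConv_mul_DeltaW ha hb hΔ c' ha₁ d hprime.pos hk1
      (fun l => a₂ (d * k) / ((k : ℂ) * (Nat.totient k : ℂ)) * nonprincTwist l p k)
      (G := ‖a₂ (d * k) / ((k : ℂ) * (Nat.totient k : ℂ))‖ *
        (((Finset.univ : Finset (DirichletCharacter ℂ k)).card : ℝ) * k))
      (fun l => by
        rw [norm_mul]
        exact mul_le_mul_of_nonneg_left (norm_nonprincTwist_le l p k) (norm_nonneg _))
    refine Summable.of_norm_bounded hbase.norm fun l => ?_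
    split_ifs with h
    · apply le_of_eq; congr 1; ring
    · rw [norm_zero]; exact norm_nonneg _
  rw [← hS1.tsum_add hS2]
  refine tsum_congr fun l => ?_
  rw [← Finset.sum_add_distrib]
  refine Finset.sum_congr rfl fun k hk => ?_
  obtain ⟨hkI, hkl⟩ := Finset.mem_filter.mp hk
  have hk1 : 0 < k := by rw [Finset.mem_Ico] at hkI; omega
  have hcopkp : Nat.Coprime p k := Nat.coprime_of_lt_prime (by omega) (hkp k hkI) hprime
  have key := step7u028_holds k p l hk1 hkl.symm hcopkp
  rw [key]
  have hφ : (Nat.totient k : ℂ) ≠ 0 := by exact_mod_cast (Nat.totient_pos.mpr hk1).ne'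
  have hk0 : (k : ℂ) ≠ 0 := by exact_mod_cast hk1.ne'
  field_simp

/-- **Kernel edge `Lemma 5.3 → (7.8) → (7.9)`** (Lemma 5.3 = the node `Skeleton.Lemma53`, a THEOREM
of the tree — `Skeleton.lemma53_holds` in `DischargeLemma53` — supplies the absolute convergence of
the `l`-series; taken as a hypothesis so that this file does not depend on that module): "Inserting
this into (7.8) we deduce (7.9)", same `c` and implied constant.
[cite: Zhang2022LandauSiegel, §7 (7.9) p. 36, tex L1959] -/
theorem eq79_of_eq78 (c' : ℝ) (h53 : Skeleton.Lemma53) (h78 : Eq78 c') : Eq79 c' := by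
  intro B
  obtain ⟨c, hc, C, h78'⟩ := h78 B
  obtain ⟨c5, -, C5, h53⟩ := h53
  refine ⟨c, hc, C, ?_⟩
  have hall := (h78'.and h53).and
    (Skeleton.ForAllLarge.of_le (S := fun D _ _ => 3 ≤ D) 3 (fun D _ _ hD _ _ => hD))
  refine hall.mono fun D _ χ _ _ hDall hA a₁ a₂ ha₁ ha₂ p hp => ?_
  obtain ⟨⟨hA78, hA53⟩, hD3⟩ := hDall
  have hL : 0 < Skeleton.ell D := by
    rw [Skeleton.ell]; exact Real.log_pos (by exact_mod_cast (by omega : 1 < D))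
  have hL2 : 0 < Skeleton.ell2 D := by rw [Skeleton.ell2]; positivity
  have ht0 : 0 ≤ Skeleton.t0 D ^ (1.02 : ℝ) := Real.rpow_nonneg (by rw [Skeleton.t0]; positivity) _
  have hΔ : ∀ x : ℝ, Skeleton.t0 D ^ (1.02 : ℝ) < x → ‖Skeleton.DeltaW D x‖ ≤
      C5 * (Real.exp (-((1 : ℝ) / 100 * Skeleton.ell2 D * Real.log x) ^ 2) +
        Real.exp (-(x ^ (0.99 : ℝ)) / Skeleton.ell2 D)) :=
    fun x hx => (hA53 x (lt_of_le_of_lt ht0 hx)).2 hx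
  rw [← rhs78_eq_frakT11_add_frakT12 c' hp ha₁.1 (a := (1 : ℝ) / 100 * Skeleton.ell2 D)
    (by positivity) hL2 hΔ]
  exact hA78 hA a₁ a₂ ha₁ ha₂ p hp

/-! ## The edge `§7.u022 ⇒ §7.u023` (summing over the primitive characters mod `p`) -/

/-- `|Δ₁(x)| = |Δ(x)|` ((5.7): `Δ = Δ₁·e(x)`, `|e(x)| = 1`). [cite: Zhang2022LandauSiegel, §5 (5.7) p. 26] -/
theorem norm_Delta1W_eq (D : ℕ) (x : ℝ) : ‖Iface.Delta1W D x‖ = ‖Skeleton.DeltaW D x‖ := by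
  simp only [Skeleton.DeltaW, Lemma53.Delta57, Iface.Delta1W]
  rw [norm_mul, show (2 * π * I * x : ℂ) = ((2 * π * x : ℝ) : ℂ) * I by push_cast; ring,
    Complex.norm_exp_ofReal_mul_I, mul_one]

/-- The number of members of `Ψ` with modulus `p` (a window prime) is at most `p` (there are `p − 2`
primitive characters mod `p`). [cite: MontgomeryVaughan2007, §9.1] -/
theorem card_finsetOf_modulus_le {D p : ℕ} (hp : p ∈ Skeleton.primeWindow D) :
    ((Skeleton.finsetOf {x : Skeleton.Chr D | x.p = p}).card : ℝ) ≤ p := by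
  classical
  have hprime : p.Prime := (Finset.mem_filter.mp hp).2
  haveI : Fact p.Prime := ⟨hprime⟩
  have h1 : (sumPrimAt D p (fun _ => (1 : ℂ))) =
      ∑ ψ ∈ (Finset.univ : Finset (DirichletCharacter ℂ p)).erase 1, (1 : ℂ) :=
    sumPrimAt_eq_sum_erase hp (fun _ => (1 : ℂ)) (fun _ => (1 : ℂ)) (fun _ _ => rfl)
  simp only [sumPrimAt, Finset.sum_const, nsmul_eq_mul, mul_one] at h1
  have hcard : (Skeleton.finsetOf {x : Skeleton.Chr D | x.p = p}).card =
      ((Finset.univ : Finset (DirichletCharacter ℂ p)).erase 1).card := by exact_mod_cast h1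
  have htot : (Finset.univ : Finset (DirichletCharacter ℂ p)).card = p.totient := by
    have h := DirichletCharacter.sum_characters_eq (R := ℂ) (n := p) 1
    simp only [map_one, Finset.sum_const, nsmul_eq_mul, mul_one, if_true] at h
    exact_mod_cast h
  rw [hcard]
  have h2 : ((Finset.univ : Finset (DirichletCharacter ℂ p)).erase 1).card ≤ p := by
    calc ((Finset.univ : Finset (DirichletCharacter ℂ p)).erase 1).card
        ≤ (Finset.univ : Finset (DirichletCharacter ℂ p)).card :=
          Finset.card_le_card (Finset.erase_subset _ _)
      _ = p.totient := htot
      _ ≤ p := Nat.totient_le p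
  exact_mod_cast h2

/-- **Summing the term-by-term formula over `ψ (mod p)`**: `Σ*_{ψ} [τ(ψ̄)/p ΣΣ …ψ(m)ψ̄(n)…] =
p⁻¹ ΣΣ … (Σ*_{ψ} τ(ψ̄)ψ(m)ψ̄(n))`, i.e. `Σ*_{ψ} I1termwise = rhs7u023`, exchanging the finite character
sum with the absolutely convergent `m`-series (Lemma 5.3 (5.9), `|Δ₁| = |Δ|`).
[cite: Zhang2022LandauSiegel, §7 p. 36, tex L1925–L1929] -/
theorem sum_I1termwise_eq_rhs7u023 (c' : ℝ) {D p : ℕ} (hp : p ∈ Skeleton.primeWindow D)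
    {a₁ a₂ : ℕ → ℂ} {B : ℝ} (ha₁ : ∀ n, ‖a₁ n‖ ≤ B) (ha₂ : ∀ n, ‖a₂ n‖ ≤ B)
    {C a b T : ℝ} (ha : 0 < a) (hb : 0 < b)
    (hΔ : ∀ x : ℝ, T < x → ‖Skeleton.DeltaW D x‖ ≤
      C * (Real.exp (-(a * Real.log x) ^ 2) + Real.exp (-(x ^ (0.99 : ℝ)) / b))) :
    sumPrimAt D p (fun x => I1termwise c' x a₁ a₂) = rhs7u023 c' D p a₁ a₂ := by
  classical
  have hprime : p.Prime := (Finset.mem_filter.mp hp).2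
  haveI : Fact p.Prime := ⟨hprime⟩
  have hp0 : (0 : ℝ) < p := by exact_mod_cast hprime.pos
  have hB : 0 ≤ B := le_trans (norm_nonneg _) (ha₁ 0)
  have hΔ1 : ∀ x : ℝ, T < x → ‖Iface.Delta1W D x‖ ≤
      C * (Real.exp (-(a * Real.log x) ^ 2) + Real.exp (-(x ^ (0.99 : ℝ)) / b)) := by
    intro x hx; rw [norm_Delta1W_eq]; exact hΔ x hx
  -- Step 1: the character sum as a sum over `univ.erase 1`
  set E := (Finset.univ : Finset (DirichletCharacter ℂ p)).erase 1 with hE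
  set F : DirichletCharacter ℂ p → ℕ → ℂ := fun ψ m =>
    ∑ n ∈ Finset.Ico 1 (Skeleton.Nsupp D),
      kappaConv c' D a₁ m * a₂ n * ψ (m : ZMod p) * ψ⁻¹ (n : ZMod p) / (n : ℂ) *
        Iface.Delta1W D ((m : ℝ) / ((p : ℝ) * n)) with hF
  have hL : sumPrimAt D p (fun x => I1termwise c' x a₁ a₂) =
      ∑ ψ ∈ E, GammaFactor.tau ψ⁻¹ / (p : ℂ) * ∑' m : ℕ, F ψ m := by
    refine sumPrimAt_eq_sum_erase hp _ _ ?_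
    rintro ⟨p', mem, ψ, prim⟩ hx
    change p' = p at hx
    subst hx
    rfl
  have hT : ∀ m n : ℕ, tauTwist D p m n =
      ∑ ψ ∈ E, GammaFactor.tau ψ⁻¹ * ψ (m : ZMod p) * ψ⁻¹ (n : ZMod p) := by
    intro m n
    refine sumPrimAt_eq_sum_erase hp _ _ ?_
    rintro ⟨p', mem, ψ, prim⟩ hx
    change p' = p at hx
    subst hx
    rfl
  -- Step 2: summability of each `m`-series
  have hS : ∀ ψ ∈ E, Summable (fun m : ℕ => GammaFactor.tau ψ⁻¹ / (p : ℂ) * F ψ m) := by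
    intro ψ _
    refine Summable.mul_left _ ?_
    simp only [hF]
    refine summable_sum fun n hn => ?_
    have hn1 : 0 < n := by rw [Finset.mem_Ico] at hn; omega
    have hq : (0 : ℝ) < (p : ℝ) * n := by positivity
    have hgen := summable_mul_of_decay (Φ := Iface.Delta1W D) ha hb hΔ1 hq
      (f := fun m => kappaConv c' D a₁ m * a₂ n * ψ (m : ZMod p) * ψ⁻¹ (n : ZMod p) / (n : ℂ))
      (M := B * B) (fun m => by
        have h1 : ‖kappaConv c' D a₁ m‖ ≤ B * (m : ℝ) ^ 4 := norm_kappaConv_le c' D ha₁ m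
        have h2 : ‖a₂ n‖ ≤ B := ha₂ n
        have h3 : ‖ψ (m : ZMod p)‖ ≤ 1 := DirichletCharacter.norm_le_one _ _
        have h4 : ‖ψ⁻¹ (n : ZMod p)‖ ≤ 1 := DirichletCharacter.norm_le_one _ _
        have h5 : ‖(n : ℂ)‖⁻¹ ≤ 1 := by
          rw [Complex.norm_natCast]; exact inv_le_one_of_one_le₀ (by exact_mod_cast hn1)
        rw [norm_div, norm_mul, norm_mul, norm_mul, div_eq_mul_inv]
        have hm4 : 0 ≤ B * (m : ℝ) ^ 4 := by positivity
        calc ‖kappaConv c' D a₁ m‖ * ‖a₂ n‖ * ‖ψ (m : ZMod p)‖ * ‖ψ⁻¹ (n : ZMod p)‖ * ‖(n : ℂ)‖⁻¹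
            ≤ B * (m : ℝ) ^ 4 * B * 1 * 1 * 1 := by
              refine mul_le_mul (mul_le_mul (mul_le_mul (mul_le_mul h1 h2 (norm_nonneg _) hm4)
                h3 (norm_nonneg _) (by positivity)) h4 (norm_nonneg _) (by positivity)) h5
                (by positivity) (by positivity)
          _ = B * B * (m : ℝ) ^ 4 := by ring)
    exact hgen
  -- Step 3: exchange and compare termwise in `m`
  rw [hL]
  have hpull : ∀ ψ ∈ E, GammaFactor.tau ψ⁻¹ / (p : ℂ) * ∑' m : ℕ, F ψ m =
      ∑' m : ℕ, GammaFactor.tau ψ⁻¹ / (p : ℂ) * F ψ m := fun ψ _ => (tsum_mul_left).symm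
  rw [Finset.sum_congr rfl hpull, ← Summable.tsum_finsetSum hS]
  unfold rhs7u023
  rw [← tsum_mul_left]
  refine tsum_congr fun m => ?_
  simp only [hF, hT, Finset.mul_sum]
  rw [Finset.sum_comm]
  refine Finset.sum_congr rfl fun n _ => ?_
  refine Finset.sum_congr rfl fun ψ _ => ?_
  ring

/-- **Kernel edge `Lemma 5.3 → §7.u022 → §7.u023`**: summing the term-by-term formula over the
primitive `ψ (mod p)` ("This yields …", tex L1925); the `≤ p` error terms `O(ε)` add up to
`p·Ce^{−c𝓛¹⁰} ≤ |C|e^{−(c/2)𝓛¹⁰}` for `𝓛 ≥ 2/c + 2` (Zhang's "`c` not necessarily the same at each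
occurrence"). [cite: Zhang2022LandauSiegel, §7 p. 36, tex L1925–L1929] -/
theorem step7u023_of_step7u022 (c' : ℝ) (h53 : Skeleton.Lemma53) (h22 : Step7u022 c') :
    Step7u023 c' := by
  intro B
  obtain ⟨c, hc, C, h22'⟩ := h22 B
  obtain ⟨c5, -, C5, h53'⟩ := h53
  refine ⟨c / 2, by positivity, |C|, ?_⟩
  have hall := (h22'.and h53').and
    (Skeleton.ForAllLarge.of_le (S := fun D _ _ => max 3 ⌈Real.exp (2 / c + 2)⌉₊ ≤ D)
      (max 3 ⌈Real.exp (2 / c + 2)⌉₊) (fun D _ _ hD _ _ => hD))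
  refine hall.mono fun D _ χ _ _ hDall hA a₁ a₂ ha₁ ha₂ p hp => ?_
  obtain ⟨⟨hA22, hA53⟩, hD⟩ := hDall
  have hD3 : 3 ≤ D := le_trans (le_max_left _ _) hD
  have hDe : ⌈Real.exp (2 / c + 2)⌉₊ ≤ D := le_trans (le_max_right _ _) hD
  -- parameters
  have hLc : 2 / c + 2 ≤ Skeleton.ell D := by
    have h : Real.exp (2 / c + 2) ≤ D := le_trans (Nat.le_ceil _) (by exact_mod_cast hDe)
    exact (Real.le_log_iff_exp_le (lt_of_lt_of_le (Real.exp_pos _) h)).mpr h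
  set L := Skeleton.ell D with hLdef
  have hc2 : 0 < 2 / c := by positivity
  have hL2 : 2 ≤ L := by linarith
  have hL1 : 1 ≤ L := by linarith
  have hL0 : 0 < L := by linarith
  have hL2' : 0 < Skeleton.ell2 D := by rw [Skeleton.ell2]; positivity
  have ht0 : 0 ≤ Skeleton.t0 D ^ (1.02 : ℝ) :=
    Real.rpow_nonneg (by rw [Skeleton.t0]; positivity) _
  have hΔ : ∀ x : ℝ, Skeleton.t0 D ^ (1.02 : ℝ) < x → ‖Skeleton.DeltaW D x‖ ≤
      C5 * (Real.exp (-((1 : ℝ) / 100 * Skeleton.ell2 D * Real.log x) ^ 2) +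
        Real.exp (-(x ^ (0.99 : ℝ)) / Skeleton.ell2 D)) :=
    fun x hx => (hA53 x (lt_of_le_of_lt ht0 hx)).2 hx
  have hId := sum_I1termwise_eq_rhs7u023 c' hp ha₁.1 ha₂.1 (a := (1 : ℝ) / 100 * Skeleton.ell2 D)
    (by positivity) hL2' hΔ
  have hsplit : sumPrimAt D p (fun x => I1psi c' x a₁ a₂) - rhs7u023 c' D p a₁ a₂ =
      ∑ x ∈ Skeleton.finsetOf {x : Skeleton.Chr D | x.p = p},
        (I1psi c' x a₁ a₂ - I1termwise c' x a₁ a₂) := by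
    rw [← hId]; unfold sumPrimAt; rw [Finset.sum_sub_distrib]
  rw [hsplit]
  -- p·e^{-c L^10} ≤ e^{-(c/2) L^10}
  have hp' := hp
  simp only [Skeleton.primeWindow, Finset.mem_filter, Finset.mem_Ioo] at hp'
  have hPpos : 0 < Skeleton.bigP D := Real.exp_pos _
  have hpU : (p : ℝ) < Skeleton.bigP D * (1 + (L ^ 68)⁻¹) := Nat.lt_ceil.mp hp'.1.2
  have hinv : (L ^ 68)⁻¹ ≤ 1 := inv_le_one_of_one_le₀ (one_le_pow₀ hL1)
  have hp2P : (p : ℝ) ≤ 2 * Skeleton.bigP D := by nlinarith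
  have hexp : (p : ℝ) * Real.exp (-c * L ^ 10) ≤ Real.exp (-(c / 2) * L ^ 10) := by
    have h2P : 2 * Skeleton.bigP D ≤ Real.exp (L ^ 9 + 1) := by
      rw [Skeleton.bigP, Real.exp_add, mul_comm]
      have : (2 : ℝ) ≤ Real.exp 1 := by
        have := Real.add_one_le_exp (1 : ℝ); linarith
      exact mul_le_mul_of_nonneg_left this (Real.exp_pos _).le
    have hkey : L ^ 9 + 1 + -c * L ^ 10 ≤ -(c / 2) * L ^ 10 := by
      -- (c/2) L^10 ≥ L^9 + 1  since  c L ≥ 2 + 2c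
      have hcL : 2 + 2 * c ≤ c * L := by
        have := mul_le_mul_of_nonneg_left hLc hc.le
        rw [mul_add, mul_div_cancel₀ _ hc.ne'] at this
        linarith
      have hL8 : 1 ≤ L ^ 8 := one_le_pow₀ hL1
      have hL9 : L ^ 9 = L * L ^ 8 := by ring
      have hL10 : L ^ 10 = L * L ^ 9 := by ring
      nlinarith [mul_le_mul_of_nonneg_right hcL (show 0 ≤ L ^ 9 by positivity),
        mul_le_mul_of_nonneg_left hL8 (show (0:ℝ) ≤ 2 by norm_num)]
    calc (p : ℝ) * Real.exp (-c * L ^ 10) ≤ Real.exp (L ^ 9 + 1) * Real.exp (-c * L ^ 10) :=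
          mul_le_mul_of_nonneg_right (hp2P.trans h2P) (Real.exp_pos _).le
      _ = Real.exp (L ^ 9 + 1 + -c * L ^ 10) := by rw [← Real.exp_add]
      _ ≤ Real.exp (-(c / 2) * L ^ 10) := Real.exp_le_exp.mpr hkey
  have hcard := card_finsetOf_modulus_le hp
  calc ‖∑ x ∈ Skeleton.finsetOf {x : Skeleton.Chr D | x.p = p},
          (I1psi c' x a₁ a₂ - I1termwise c' x a₁ a₂)‖
      ≤ ∑ x ∈ Skeleton.finsetOf {x : Skeleton.Chr D | x.p = p},
          ‖I1psi c' x a₁ a₂ - I1termwise c' x a₁ a₂‖ := norm_sum_le _ _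
    _ ≤ ∑ x ∈ Skeleton.finsetOf {x : Skeleton.Chr D | x.p = p}, |C| * Real.exp (-c * L ^ 10) := by
        refine Finset.sum_le_sum fun x _ => le_trans (hA22 hA a₁ a₂ ha₁ ha₂ x) ?_
        exact mul_le_mul_of_nonneg_right (le_abs_self C) (Real.exp_pos _).le
    _ = ((Skeleton.finsetOf {x : Skeleton.Chr D | x.p = p}).card : ℝ) *
          (|C| * Real.exp (-c * L ^ 10)) := by rw [Finset.sum_const, nsmul_eq_mul]
    _ ≤ (p : ℝ) * (|C| * Real.exp (-c * L ^ 10)) :=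
        mul_le_mul_of_nonneg_right hcard (by positivity)
    _ = |C| * ((p : ℝ) * Real.exp (-c * L ^ 10)) := by ring
    _ ≤ |C| * Real.exp (-(c / 2) * L ^ 10) := mul_le_mul_of_nonneg_left hexp (abs_nonneg C)

/-! ## The `d = (m,n)` substitution (`Z22:§7.u024`) -/

/-- Every `k < PT⁻²` (the support bound (7.2)) is below every window prime: `k < PT⁻² ≤ P < q`.
[cite: Zhang2022LandauSiegel, §7 p. 36, tex L1930] -/
theorem lt_of_mem_Ico_Nsupp {D k q : ℕ} (hk : k ∈ Finset.Ico 1 (Skeleton.Nsupp D))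
    (hq : q ∈ Skeleton.primeWindow D) : k < q := by
  have hq' := hq
  simp only [Skeleton.primeWindow, Finset.mem_filter, Finset.mem_Ioo] at hq'
  have hPpos : 0 < Skeleton.bigP D := Real.exp_pos _
  have hPq : Skeleton.bigP D < q := (Nat.floor_lt hPpos.le).mp hq'.1.1
  rw [Finset.mem_Ico] at hk
  have hkP : (k : ℝ) < Skeleton.bigP D / Skeleton.bigT D ^ 2 := Nat.lt_ceil.mp hk.2
  have h1 : Skeleton.bigP D / Skeleton.bigT D ^ 2 ≤ Skeleton.bigP D :=
    div_le_self hPpos.le (one_le_pow₀ (one_le_bigT D))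
  exact_mod_cast (hkP.trans_le h1).trans hPq

/-- "Note that `(n,p) = 1` if `n < PT⁻²`" (tex L1930): for `d < PT⁻²` the character sum
`Σ*_ψ τ(ψ̄)ψ(dl)ψ̄(dk)` equals `Σ*_ψ τ(ψ̄)ψ(l)ψ̄(k)` (`ψ(d)ψ̄(d) = 1`).
[cite: Zhang2022LandauSiegel, §7 p. 36, tex L1930] -/
theorem tauTwist_mul_left {D : ℕ} (p : ℕ) {d : ℕ} (hd : d ∈ Finset.Ico 1 (Skeleton.Nsupp D))
    (l k : ℕ) : tauTwist D p (d * l) (d * k) = tauTwist D p l k := by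
  unfold tauTwist sumPrimAt
  refine Finset.sum_congr rfl fun x _ => ?_
  have hprime : x.p.Prime := (Finset.mem_filter.mp x.mem).2
  have hdlt : d < x.p := lt_of_mem_Ico_Nsupp hd x.mem
  have hd1 : 1 ≤ d := (Finset.mem_Ico.mp hd).1
  have hcop : Nat.Coprime x.p d := Nat.coprime_of_lt_prime (by omega) hdlt hprime
  have hunit : IsUnit ((d : ℕ) : ZMod x.p) := (ZMod.isUnit_iff_coprime d x.p).mpr hcop.symm
  have h1 : x.ψ (d : ZMod x.p) * x.ψ⁻¹ (d : ZMod x.p) = 1 := by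
    rw [← MulChar.mul_apply, mul_inv_cancel, MulChar.one_apply hunit]
  push_cast
  rw [map_mul, map_mul]
  calc GammaFactor.tau x.ψ⁻¹ * (x.ψ (d : ZMod x.p) * x.ψ (l : ZMod x.p)) *
        (x.ψ⁻¹ (d : ZMod x.p) * x.ψ⁻¹ (k : ZMod x.p))
      = GammaFactor.tau x.ψ⁻¹ * x.ψ (l : ZMod x.p) * x.ψ⁻¹ (k : ZMod x.p) *
          (x.ψ (d : ZMod x.p) * x.ψ⁻¹ (d : ZMod x.p)) := by ring
    _ = GammaFactor.tau x.ψ⁻¹ * x.ψ (l : ZMod x.p) * x.ψ⁻¹ (k : ZMod x.p) := by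
        rw [h1, mul_one]

/-- A crude uniform bound for the character sum `Σ*_{ψ (mod p)} τ(ψ̄)ψ(m)ψ̄(n)`:
`≤ #{ψ} · ⌈P(1+𝓛⁻⁶⁸)⌉` (`|τ(ψ̄)| ≤` modulus `< ⌈P(1+𝓛⁻⁶⁸)⌉`, `|ψ| ≤ 1`), uniform in `m, n`.
[cite: Zhang2022LandauSiegel, §7 p. 36, tex L1928] -/
theorem norm_tauTwist_le (D p m n : ℕ) :
    ‖tauTwist D p m n‖ ≤ ((Skeleton.finsetOf {x : Skeleton.Chr D | x.p = p}).card : ℝ) *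
      ⌈Skeleton.bigP D * (1 + (Skeleton.ell D ^ 68)⁻¹)⌉₊ := by
  unfold tauTwist sumPrimAt
  set U : ℕ := ⌈Skeleton.bigP D * (1 + (Skeleton.ell D ^ 68)⁻¹)⌉₊ with hU
  calc ‖∑ x ∈ Skeleton.finsetOf {x : Skeleton.Chr D | x.p = p},
          GammaFactor.tau x.ψ⁻¹ * x.ψ (m : ZMod x.p) * x.ψ⁻¹ (n : ZMod x.p)‖
      ≤ ∑ x ∈ Skeleton.finsetOf {x : Skeleton.Chr D | x.p = p},
          ‖GammaFactor.tau x.ψ⁻¹ * x.ψ (m : ZMod x.p) * x.ψ⁻¹ (n : ZMod x.p)‖ := norm_sum_le _ _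
    _ ≤ ∑ x ∈ Skeleton.finsetOf {x : Skeleton.Chr D | x.p = p}, (U : ℝ) := by
        refine Finset.sum_le_sum fun x _ => ?_
        have hprime : x.p.Prime := (Finset.mem_filter.mp x.mem).2
        haveI : NeZero x.p := ⟨hprime.ne_zero⟩
        have hxU : x.p < U := (Finset.mem_Ioo.mp (Finset.mem_filter.mp x.mem).1).2
        have h1 : ‖GammaFactor.tau x.ψ⁻¹‖ ≤ x.p := by
          show ‖gaussSum x.ψ⁻¹ (ZMod.stdAddChar (N := x.p))‖ ≤ x.p
          rw [gaussSum]
          calc ‖∑ a : ZMod x.p, x.ψ⁻¹ a * ZMod.stdAddChar a‖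
              ≤ ∑ a : ZMod x.p, ‖x.ψ⁻¹ a * ZMod.stdAddChar a‖ := norm_sum_le _ _
            _ ≤ ∑ a : ZMod x.p, (1 : ℝ) := Finset.sum_le_sum fun a _ => by
                rw [norm_mul, AddChar.norm_apply, mul_one]
                exact DirichletCharacter.norm_le_one _ _
            _ = x.p := by simp
        have h2 : ‖x.ψ (m : ZMod x.p)‖ ≤ 1 := DirichletCharacter.norm_le_one _ _
        have h3 : ‖x.ψ⁻¹ (n : ZMod x.p)‖ ≤ 1 := DirichletCharacter.norm_le_one _ _
        rw [norm_mul, norm_mul]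
        calc ‖GammaFactor.tau x.ψ⁻¹‖ * ‖x.ψ (m : ZMod x.p)‖ * ‖x.ψ⁻¹ (n : ZMod x.p)‖
            ≤ (x.p : ℝ) * 1 * 1 :=
              mul_le_mul (mul_le_mul h1 h2 (norm_nonneg _) (Nat.cast_nonneg _)) h3
                (norm_nonneg _) (by positivity)
          _ ≤ U := by rw [mul_one, mul_one]; exact_mod_cast hxU.le
    _ = _ := by rw [Finset.sum_const, nsmul_eq_mul]

/-- Summability of the generic `l`-series `Σ_l (κ∗a₁)(dl)·g(l)·Φ(l/(pk))` with `g` bounded and `Φ`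
obeying the (5.9)-type bound (`Φ = Δ` or `Δ₁`). [cite: Zhang2022LandauSiegel, §5 (5.9) p. 25] -/
theorem summable_kappaConv_mul_of_decay {D : ℕ} {Φ : ℝ → ℂ} {C a b T : ℝ} (ha : 0 < a)
    (hb : 0 < b) (hΦ : ∀ x : ℝ, T < x → ‖Φ x‖ ≤
      C * (Real.exp (-(a * Real.log x) ^ 2) + Real.exp (-(x ^ (0.99 : ℝ)) / b)))
    (c' : ℝ) {a₁ : ℕ → ℂ} {B : ℝ} (ha₁ : ∀ n, ‖a₁ n‖ ≤ B) (d : ℕ) {p k : ℕ} (hp0 : 0 < p)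
    (hk0 : 0 < k) (g : ℕ → ℂ) {G : ℝ} (hg : ∀ l, ‖g l‖ ≤ G) :
    Summable (fun l : ℕ => kappaConv c' D a₁ (d * l) * g l * Φ ((l : ℝ) / ((p : ℝ) * k))) := by
  have hB : 0 ≤ B := le_trans (norm_nonneg _) (ha₁ 0)
  have hG : 0 ≤ G := le_trans (norm_nonneg _) (hg 0)
  have hq : (0 : ℝ) < (p : ℝ) * k := by positivity
  refine summable_mul_of_decay (f := fun l => kappaConv c' D a₁ (d * l) * g l)
    (M := B * (d : ℝ) ^ 4 * G) ha hb hΦ hq fun l => ?_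
  rw [norm_mul]
  calc ‖kappaConv c' D a₁ (d * l)‖ * ‖g l‖ ≤ (B * ((d * l : ℕ) : ℝ) ^ 4) * G :=
        mul_le_mul (norm_kappaConv_le c' D ha₁ _) (hg l) (norm_nonneg _) (by positivity)
    _ = B * (d : ℝ) ^ 4 * G * (l : ℝ) ^ 4 := by push_cast; ring

/-- The term identity behind "`m = dl`, `n = dk`": for `1 ≤ d < PT⁻²`, `k ≥ 1`,
`(κ∗a₁)(dl)a₂(dk)(dk)⁻¹Δ₁(dl/(p·dk))·Σ*τ(ψ̄)ψ(dl)ψ̄(dk) = d⁻¹·[(κ∗a₁)(dl)a₂(dk)k⁻¹(Σ*τ(ψ̄)ψ(l)ψ̄(k))Δ₁(l/(pk))]`.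
[cite: Zhang2022LandauSiegel, §7 p. 36, tex L1930–L1934] -/
theorem u024_term (c' : ℝ) {D : ℕ} (p : ℕ) (a₁ a₂ : ℕ → ℂ) {d : ℕ}
    (hd : d ∈ Finset.Ico 1 (Skeleton.Nsupp D)) {k : ℕ} (hk : 0 < k) (l : ℕ) :
    kappaConv c' D a₁ (d * l) * a₂ (d * k) / ((d * k : ℕ) : ℂ) *
        Iface.Delta1W D (((d * l : ℕ) : ℝ) / ((p : ℝ) * ((d * k : ℕ) : ℝ))) *
        tauTwist D p (d * l) (d * k) =
      1 / (d : ℂ) * (kappaConv c' D a₁ (d * l) * a₂ (d * k) / (k : ℂ) * tauTwist D p l k *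
        Iface.Delta1W D ((l : ℝ) / ((p : ℝ) * k))) := by
  have hd1 : 1 ≤ d := (Finset.mem_Ico.mp hd).1
  have hdR : (d : ℝ) ≠ 0 := by exact_mod_cast (show d ≠ 0 by omega)
  have hdC : (d : ℂ) ≠ 0 := by exact_mod_cast (show d ≠ 0 by omega)
  have hkC : (k : ℂ) ≠ 0 := by exact_mod_cast hk.ne'
  have hx : ((d * l : ℕ) : ℝ) / ((p : ℝ) * ((d * k : ℕ) : ℝ)) = (l : ℝ) / ((p : ℝ) * k) := by
    push_cast
    rw [show (p : ℝ) * ((d : ℝ) * k) = (d : ℝ) * ((p : ℝ) * k) by ring]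
    exact mul_div_mul_left _ _ hdR
  rw [hx, tauTwist_mul_left p hd l k]
  push_cast
  field_simp

/-- **The `d = (m,n)` substitution is exact**: `rhs7u023 = rhs7u024` for `𝐚₂` supported below
`PT⁻²` and bounded `𝐚₁, 𝐚₂`, once `Δ` (equivalently `Δ₁`, `|Δ₁| = |Δ|`) obeys a (5.9)-type bound
(absolute convergence). For each `m` the finite `n`-sum is re-indexed by the bijection
`n ↦ (d,k) = ((m,n), n/(m,n))` onto `{d ∣ m, (k, m/d) = 1, dk < PT⁻²}`; the `l`-series are then
re-indexed by `l ↦ m = dl` and exchanged with the finite `d`-sum.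
[cite: Zhang2022LandauSiegel, §7 p. 36, tex L1930–L1934] -/
theorem rhs7u023_eq_rhs7u024 (c' : ℝ) {D p : ℕ} (hp : p ∈ Skeleton.primeWindow D)
    {a₁ a₂ : ℕ → ℂ} {B : ℝ} (ha₁ : ∀ n, ‖a₁ n‖ ≤ B)
    (ha₂0 : ∀ n : ℕ, Skeleton.Nsupp D ≤ n → a₂ n = 0)
    {C a b T : ℝ} (ha : 0 < a) (hb : 0 < b)
    (hΔ : ∀ x : ℝ, T < x → ‖Skeleton.DeltaW D x‖ ≤
      C * (Real.exp (-(a * Real.log x) ^ 2) + Real.exp (-(x ^ (0.99 : ℝ)) / b))) :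
    rhs7u023 c' D p a₁ a₂ = rhs7u024 c' D p a₁ a₂ := by
  classical
  have hprime : p.Prime := (Finset.mem_filter.mp hp).2
  have hp0 : 0 < p := hprime.pos
  have hB : 0 ≤ B := le_trans (norm_nonneg _) (ha₁ 0)
  have hΔ1 : ∀ x : ℝ, T < x → ‖Iface.Delta1W D x‖ ≤
      C * (Real.exp (-(a * Real.log x) ^ 2) + Real.exp (-(x ^ (0.99 : ℝ)) / b)) := by
    intro x hx; rw [norm_Delta1W_eq]; exact hΔ x hx
  set N := Skeleton.Nsupp D with hN
  set I := Finset.Ico 1 N with hI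
  -- the summands
  set g : ℕ → ℕ → ℕ → ℂ := fun d l k =>
    kappaConv c' D a₁ (d * l) * a₂ (d * k) / (k : ℂ) * tauTwist D p l k *
      Iface.Delta1W D ((l : ℝ) / ((p : ℝ) * k)) with hg
  set A : ℕ → ℕ → ℂ := fun d l => ∑ k ∈ I.filter (fun k => Nat.Coprime k l), g d l k with hA
  set Ah : ℕ → ℕ → ℂ := fun d m => if d ∣ m then A d (m / d) else 0 with hAh
  set f : ℕ → ℕ → ℂ := fun m n =>
    kappaConv c' D a₁ m * a₂ n / (n : ℂ) * Iface.Delta1W D ((m : ℝ) / ((p : ℝ) * n)) *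
      tauTwist D p m n with hf
  -- Step 1: summability of each `l`-series `A d`
  have hAs : ∀ d : ℕ, Summable (A d) := by
    intro d
    have hfun : A d = fun l : ℕ => ∑ k ∈ I, if Nat.Coprime k l then g d l k else 0 := by
      funext l; simp only [hA]; rw [Finset.sum_filter]
    rw [hfun]
    refine summable_sum fun k hk => ?_
    have hk1 : 0 < k := by rw [hI, Finset.mem_Ico] at hk; omega
    have hbase := summable_kappaConv_mul_of_decay (D := D) (Φ := Iface.Delta1W D) ha hb hΔ1 c'
      ha₁ d hp0
      hk1 (fun l => a₂ (d * k) / (k : ℂ) * tauTwist D p l k)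
      (G := ‖a₂ (d * k) / (k : ℂ)‖ *
        (((Skeleton.finsetOf {x : Skeleton.Chr D | x.p = p}).card : ℝ) *
          ⌈Skeleton.bigP D * (1 + (Skeleton.ell D ^ 68)⁻¹)⌉₊))
      (fun l => by
        rw [norm_mul]
        exact mul_le_mul_of_nonneg_left (norm_tauTwist_le D p l k) (norm_nonneg _))
    refine Summable.of_norm_bounded hbase.norm fun l => ?_
    split_ifs with h
    · apply le_of_eq; simp only [hg]; congr 1; ring
    · rw [norm_zero]; exact norm_nonneg _
  -- Step 2: re-index `l ↦ m = dl`
  have hinj : ∀ d : ℕ, 0 < d → Function.Injective (fun l : ℕ => d * l) :=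
    fun d hd => mul_right_injective₀ hd.ne'
  have hcomp : ∀ d : ℕ, 0 < d → (Ah d ∘ fun l : ℕ => d * l) = A d := by
    intro d hd; funext l
    show (if d ∣ d * l then A d (d * l / d) else 0) = A d l
    rw [if_pos (Dvd.intro l rfl), Nat.mul_div_cancel_left l hd]
  have hsupp : ∀ d : ℕ, 0 < d → Function.support (Ah d) ⊆ Set.range (fun l : ℕ => d * l) := by
    intro d hd m hm
    rw [Function.mem_support] at hm
    simp only [hAh] at hm
    by_cases h : d ∣ m
    · obtain ⟨l, rfl⟩ := h; exact ⟨l, rfl⟩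
    · exact absurd (if_neg h) hm
  have hreindex : ∀ d : ℕ, 0 < d → ∑' l, A d l = ∑' m, Ah d m := by
    intro d hd
    rw [← hcomp d hd]
    exact (hinj d hd).tsum_eq (hsupp d hd)
  have hsupp' : ∀ d : ℕ, 0 < d → ∀ m ∉ Set.range (fun l : ℕ => d * l), Ah d m = 0 := by
    intro d hd m hm
    by_contra h
    exact hm (hsupp d hd (Function.mem_support.mpr h))
  have hAhs : ∀ d : ℕ, 0 < d → Summable (Ah d) := by
    intro d hd
    exact ((hinj d hd).summable_iff (hsupp' d hd)).mp (by rw [hcomp d hd]; exact hAs d)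
  -- Step 3: the finite identity for each `m`
  have hfin : ∀ m : ℕ, ∑ n ∈ I, f m n = ∑ d ∈ I, 1 / (d : ℂ) * Ah d m := by
    intro m
    -- right side as a sum over pairs `(d,k)`
    set S := (I ×ˢ I).filter (fun x : ℕ × ℕ => x.1 ∣ m ∧ Nat.Coprime x.2 (m / x.1)) with hS
    set S' := (I ×ˢ I).filter
      (fun x : ℕ × ℕ => (x.1 ∣ m ∧ Nat.Coprime x.2 (m / x.1)) ∧ x.1 * x.2 < N) with hS'
    set t : ℕ × ℕ → ℂ := fun x => 1 / (x.1 : ℂ) * g x.1 (m / x.1) x.2 with ht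
    have hR1 : ∑ d ∈ I, 1 / (d : ℂ) * Ah d m = ∑ x ∈ S, t x := by
      rw [hS, Finset.sum_filter, Finset.sum_product]
      refine Finset.sum_congr rfl fun d hd => ?_
      simp only [hAh]
      split_ifs with hdm
      · simp only [hA, ht, Finset.mul_sum, Finset.sum_filter, hdm, true_and, mul_ite, mul_zero]
      · simp [hdm]
    have hR2 : ∑ x ∈ S, t x = ∑ x ∈ S', t x := by
      symm
      refine Finset.sum_subset (fun x hx => ?_) (fun x hxS hxS' => ?_)
      · rw [hS', Finset.mem_filter] at hx
        rw [hS, Finset.mem_filter]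
        exact ⟨hx.1, hx.2.1⟩
      · -- `dk ≥ N`: `a₂(dk) = 0`
        rw [hS, Finset.mem_filter] at hxS
        have hge : N ≤ x.1 * x.2 := by
          by_contra hlt
          exact hxS' (by rw [hS', Finset.mem_filter]; exact ⟨hxS.1, hxS.2, by omega⟩)
        simp only [ht, hg, ha₂0 _ hge]
        simp
    rw [hR1, hR2]
    -- the bijection `(d,k) ↦ n = dk`, inverse `n ↦ ((m,n), n/(m,n))`
    symm
    refine Finset.sum_nbij' (fun x : ℕ × ℕ => x.1 * x.2)
      (fun n : ℕ => (Nat.gcd m n, n / Nat.gcd m n)) (fun x hx => ?_) (fun n hn => ?_)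
      (fun x hx => ?_) (fun n hn => ?_) (fun x hx => ?_)
    · -- `dk ∈ I`
      rw [hS', Finset.mem_filter, Finset.mem_product] at hx
      obtain ⟨⟨hd, hk⟩, -, hlt⟩ := hx
      rw [hI, Finset.mem_Ico] at hd hk ⊢
      exact ⟨le_trans hd.1 (Nat.le_mul_of_pos_right _ (by omega)), hlt⟩
    · -- `((m,n), n/(m,n)) ∈ S'`
      rw [hI, Finset.mem_Ico] at hn
      have hn0 : 0 < n := by omega
      have hg0 : 0 < Nat.gcd m n := Nat.gcd_pos_of_pos_right _ hn0
      have hgle : Nat.gcd m n ≤ n := Nat.le_of_dvd hn0 (Nat.gcd_dvd_right m n)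
      have hdvd : Nat.gcd m n ∣ n := Nat.gcd_dvd_right m n
      have hkpos : 0 < n / Nat.gcd m n := Nat.div_pos hgle hg0
      have hkle : n / Nat.gcd m n ≤ n := Nat.div_le_self _ _
      rw [hS', Finset.mem_filter, Finset.mem_product, hI, Finset.mem_Ico, Finset.mem_Ico]
      refine ⟨⟨⟨hg0, by omega⟩, ⟨hkpos, by omega⟩⟩, ⟨Nat.gcd_dvd_left m n,
        (Nat.coprime_div_gcd_div_gcd hg0).symm⟩, ?_⟩
      rw [Nat.mul_div_cancel' hdvd]; exact hn.2
    · -- left inverse on `S'`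
      rw [hS', Finset.mem_filter, Finset.mem_product, hI, Finset.mem_Ico] at hx
      obtain ⟨⟨hd, -⟩, ⟨hdm, hcop⟩, -⟩ := hx
      obtain ⟨l, hl⟩ := hdm
      have hd0 : 0 < x.1 := by omega
      have hl' : m / x.1 = l := by rw [hl, Nat.mul_div_cancel_left l hd0]
      rw [hl'] at hcop
      have hgcd : Nat.gcd m (x.1 * x.2) = x.1 := by
        rw [hl, Nat.gcd_mul_left, Nat.gcd_comm, Nat.Coprime.gcd_eq_one hcop, mul_one]
      refine Prod.ext hgcd ?_
      show x.1 * x.2 / Nat.gcd m (x.1 * x.2) = x.2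
      rw [hgcd, Nat.mul_div_cancel_left _ hd0]
    · -- right inverse on `I`
      exact Nat.mul_div_cancel' (Nat.gcd_dvd_right m n)
    · -- the terms agree
      rw [hS', Finset.mem_filter, Finset.mem_product, hI, Finset.mem_Ico, Finset.mem_Ico] at hx
      obtain ⟨⟨hd, hk⟩, ⟨hdm, -⟩, -⟩ := hx
      obtain ⟨l, rfl⟩ := hdm
      have hd0 : 0 < x.1 := by omega
      have hdI : x.1 ∈ Finset.Ico 1 (Skeleton.Nsupp D) := by rw [Finset.mem_Ico]; exact hd
      simp only [ht, hf, hg, Nat.mul_div_cancel_left l hd0]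
      exact (u024_term c' p a₁ a₂ hdI (by omega : 0 < x.2) l).symm
  -- Step 4: assemble
  unfold rhs7u023 rhs7u024
  congr 1
  change ∑' m, ∑ n ∈ I, f m n = ∑ d ∈ I, 1 / (d : ℂ) * ∑' l, A d l
  have hR : ∑ d ∈ I, 1 / (d : ℂ) * ∑' l, A d l = ∑' m, ∑ d ∈ I, 1 / (d : ℂ) * Ah d m := by
    rw [Finset.sum_congr rfl fun d hd => by
      rw [hreindex d (by rw [hI, Finset.mem_Ico] at hd; omega), ← tsum_mul_left]]
    exact (Summable.tsum_finsetSum fun d hd =>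
      (hAhs d (by rw [hI, Finset.mem_Ico] at hd; omega)).mul_left _).symm
  rw [hR]
  exact tsum_congr hfin

/-- **Kernel edge `Lemma 5.3 → §7.u024`**: "On substituting `d = (m,n)`, `m = dl`, `n = dk`, we find
that the main term … is [rhs7u024]" (tex L1930–L1934) — EXACT for `𝐚₁, 𝐚₂` obeying (7.2) and
`p ∼ P`, the series converging absolutely by Lemma 5.3 (5.9) (the node `Skeleton.Lemma53`, a theorem
of the tree, `Skeleton.lemma53_holds`; taken as a hypothesis so that this file does not depend on
that module). [cite: Zhang2022LandauSiegel, §7 p. 36, tex L1930–L1934] -/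
theorem step7u024_of_lemma53 (c' : ℝ) (h53 : Skeleton.Lemma53) : Step7u024 c' := by
  intro B
  obtain ⟨c5, -, C5, h53'⟩ := h53
  have hall := h53'.and
    (Skeleton.ForAllLarge.of_le (S := fun D _ _ => 3 ≤ D) 3 (fun D _ _ hD _ _ => hD))
  refine hall.mono fun D _ χ _ _ hDall a₁ a₂ ha₁ ha₂ p hp => ?_
  obtain ⟨hA53, hD3⟩ := hDall
  have hD1 : (1 : ℝ) < D := by exact_mod_cast (show 1 < D by omega)
  have hL0 : 0 < Skeleton.ell D := by rw [Skeleton.ell]; exact Real.log_pos hD1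
  have hL2' : 0 < Skeleton.ell2 D := by rw [Skeleton.ell2]; positivity
  have ht0 : 0 ≤ Skeleton.t0 D ^ (1.02 : ℝ) :=
    Real.rpow_nonneg (by rw [Skeleton.t0]; positivity) _
  have hΔ : ∀ x : ℝ, Skeleton.t0 D ^ (1.02 : ℝ) < x → ‖Skeleton.DeltaW D x‖ ≤
      C5 * (Real.exp (-((1 : ℝ) / 100 * Skeleton.ell2 D * Real.log x) ^ 2) +
        Real.exp (-(x ^ (0.99 : ℝ)) / Skeleton.ell2 D)) :=
    fun x hx => (hA53 x (lt_of_le_of_lt ht0 hx)).2 hx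
  have ha₂0 : ∀ n : ℕ, Skeleton.Nsupp D ≤ n → a₂ n = 0 := fun n hn =>
    ha₂.2 n (le_trans (Nat.le_ceil _) (by exact_mod_cast hn))
  exact rhs7u023_eq_rhs7u024 c' hp ha₁.1 ha₂0 (a := (1 : ℝ) / 100 * Skeleton.ell2 D)
    (by positivity) hL2' hΔ

/-- **Kernel edge `Lemma 5.3 → §7.u022 → §7.u024-form`**: with u023 and u024 both exact modulo
`O(ε)`, `Σ*_ψ I₁(ψ) = rhs7u024 + O(ε)` — the display tex L1931–L1934 as the text uses it next
((7.7) is deduced from THIS form by Lemma 5.4). [cite: Zhang2022LandauSiegel, §7 p. 36, tex L1930–L1938] -/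
theorem sumPrimAt_I1psi_sub_rhs7u024 (c' : ℝ) (h53 : Skeleton.Lemma53) (h22 : Step7u022 c') :
    ∀ B : ℝ, ∃ c : ℝ, 0 < c ∧ ∃ C : ℝ, Skeleton.ForAllLarge fun D _ χ =>
      Skeleton.AssumptionA D χ → ∀ a₁ a₂ : ℕ → ℂ, Skeleton.Adm72 D B a₁ → Skeleton.Adm72 D B a₂ →
        ∀ p ∈ Skeleton.primeWindow D,
          ‖sumPrimAt D p (fun x => I1psi c' x a₁ a₂) - rhs7u024 c' D p a₁ a₂‖
            ≤ C * Real.exp (-c * Skeleton.ell D ^ 10) := by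
  intro B
  obtain ⟨c, hc, C, h23⟩ := step7u023_of_step7u022 c' h53 h22 B
  have h24 := step7u024_of_lemma53 c' h53 B
  refine ⟨c, hc, C, (h23.and h24).mono fun D _ χ _ _ hD hA a₁ a₂ ha₁ ha₂ p hp => ?_⟩
  rw [← hD.2 a₁ a₂ ha₁ ha₂ p hp]
  exact hD.1 hA a₁ a₂ ha₁ ha₂ p hp

/-! ## Unconditional forms (Lemma 5.3 is the tree theorem `Skeleton.lemma53_holds`) -/

/-- **`Z22:§7.u024` holds**: the `d = (m,n)` rearrangement `rhs7u023 = rhs7u024` for all large `D`,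
all `𝐚₁, 𝐚₂` obeying (7.2) and all `p ∼ P` — `step7u024_of_lemma53` fed with the tree's theorem
`Skeleton.lemma53_holds` (Lemma 5.3). [cite: Zhang2022LandauSiegel, §7 p. 36, tex L1930–L1934] -/
theorem step7u024_holds (c' : ℝ) : Step7u024 c' :=
  step7u024_of_lemma53 c' Skeleton.lemma53_holds

variable (c' : ℝ) in
/-- `Step7u024` — `_holds` alias of `step7u024_holds` above under the fact's exact name, stated under the
prover's own binders as section variables (appended 2026-08-28, D-0026 bookkeeping: the proof term is the
existing theorem of this file; no statement, definition or attribute is edited; no new named fact; the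
ledger's debt table listed the fact unproved). [cite: Zhang2022LandauSiegel, §7 p. 36, tex L1930–L1934] -/
theorem _root_.Literature.NumberTheory.LFunctions.Zhang2022.Section7bStatements.Step7u024_holds :
    _root_.Literature.NumberTheory.LFunctions.Zhang2022.Section7bStatements.Step7u024 c' :=
  _root_.Literature.NumberTheory.LFunctions.Zhang2022.Section7bStatements.step7u024_holds (c' := c')

/-- **`(7.8) ⇒ (7.9)` unconditionally** (Lemma 5.3 = `Skeleton.lemma53_holds`).
[cite: Zhang2022LandauSiegel, §7 (7.9) p. 36, tex L1959] -/
theorem eq79_of_eq78' (c' : ℝ) (h78 : Eq78 c') : Eq79 c' :=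
  eq79_of_eq78 c' Skeleton.lemma53_holds h78

/-- **`§7.u022 ⇒ §7.u023` unconditionally** (Lemma 5.3 = `Skeleton.lemma53_holds`).
[cite: Zhang2022LandauSiegel, §7 p. 36, tex L1925–L1929] -/
theorem step7u023_of_step7u022' (c' : ℝ) (h22 : Step7u022 c') : Step7u023 c' :=
  step7u023_of_step7u022 c' Skeleton.lemma53_holds h22

/-- **`§7.u022 ⇒ (Σ*_ψ I₁(ψ) = rhs7u024 + O(ε))` unconditionally** (Lemma 5.3 =
`Skeleton.lemma53_holds`). [cite: Zhang2022LandauSiegel, §7 p. 36, tex L1930–L1938] -/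
theorem sumPrimAt_I1psi_sub_rhs7u024' (c' : ℝ) (h22 : Step7u022 c') :
    ∀ B : ℝ, ∃ c : ℝ, 0 < c ∧ ∃ C : ℝ, Skeleton.ForAllLarge fun D _ χ =>
      Skeleton.AssumptionA D χ → ∀ a₁ a₂ : ℕ → ℂ, Skeleton.Adm72 D B a₁ → Skeleton.Adm72 D B a₂ →
        ∀ p ∈ Skeleton.primeWindow D,
          ‖sumPrimAt D p (fun x => I1psi c' x a₁ a₂) - rhs7u024 c' D p a₁ a₂‖
            ≤ C * Real.exp (-c * Skeleton.ell D ^ 10) :=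
  sumPrimAt_I1psi_sub_rhs7u024 c' Skeleton.lemma53_holds h22

/-- **Proposition 7.1 from its four analytic leaves**: (7.6) `Eq76`, (7.7)′ `Step7t1944` ((7.7) with
the constraint `(l,p) = 1` removed), (7.10) `Eq710`, (7.11) `Eq711` `⇒ Skeleton.Prop71 c′` — composing
`dedProp71red_holds` with `eq78_of_step7t1944`, `eq79_of_eq78'` (Lemma 5.3 = `Skeleton.lemma53_holds`)
and `step7t1972_holds`. [cite: Zhang2022LandauSiegel, §7 pp. 35–37, tex L1912–L1982] -/
theorem prop71_of_leaves (c' : ℝ) (h76 : Eq76 c') (h1944 : Step7t1944 c') (h710 : Eq710 c')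
    (h711 : Eq711 c') : Skeleton.Prop71 c' :=
  dedProp71red_holds c' h76 (eq79_of_eq78' c' (eq78_of_step7t1944 c' h1944)) (step7t1972_holds c')
    h710 h711

/-- The same as a REFINEMENT of the skeleton's proof node `Skeleton.Ded71 c′`
(`Prop21 → Lemma33a → Lemma33b → Lemma51 → Lemma52 → Lemma53 → Lemma54 → Lemma56 → Prop71`): the four
typed §7 leaves imply `Ded71 c′` outright (its banked hypotheses are then not needed for this last
step). [cite: Zhang2022LandauSiegel, §7 pp. 35–37, tex L1912–L1982] -/
theorem ded71_of_leaves (c' : ℝ) (h76 : Eq76 c') (h1944 : Step7t1944 c') (h710 : Eq710 c')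
    (h711 : Eq711 c') : Skeleton.Ded71 c' :=
  fun _ _ _ _ _ _ _ _ => prop71_of_leaves c' h76 h1944 h710 h711

/-! ## `Z22:§7.u025`, exact forms (for the (7.7) discharger) -/

/-- **`Z22:§7.u025`, EXACT form**: for a window prime `p` and `(kl,p) = 1`,
`Σ*_{ψ (mod p)} τ(ψ̄)ψ(l)ψ̄(k) = (p − 1)e(lk̄/p) + 1` (`= pe(lk̄/p) + (1 − e(lk̄/p))`, the source's
`O(1)` made explicit), `k̄ = ((k : ZMod p)⁻¹).val` — the tree's
`Literature.NumberTheory.GaussSums.sum_nontrivial_gaussSum_inv_mul_apply_mul_inv_apply` transported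
to `tauTwist`. [cite: Zhang2022LandauSiegel, §7 p. 36, tex L1936] -/
theorem tauTwist_eq {D p : ℕ} (hp : p ∈ Skeleton.primeWindow D) {k l : ℕ}
    (hkl : Nat.Coprime (k * l) p) :
    tauTwist D p l k = ((p : ℂ) - 1) *
      Complex.exp (2 * π * I * ((l : ℂ) * (((k : ZMod p)⁻¹).val : ℂ) / (p : ℂ))) + 1 := by
  classical
  have hprime : p.Prime := (Finset.mem_filter.mp hp).2
  haveI : Fact p.Prime := ⟨hprime⟩
  have hk : Nat.Coprime k p := Nat.Coprime.coprime_mul_right hkl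
  have hl : Nat.Coprime l p := Nat.Coprime.coprime_mul_left hkl
  set lU : (ZMod p)ˣ := ZMod.unitOfCoprime l hl with hlU
  set kU : (ZMod p)ˣ := ZMod.unitOfCoprime k hk with hkU
  have h := Literature.NumberTheory.GaussSums.sum_nontrivial_gaussSum_inv_mul_apply_mul_inv_apply
    (p := p) lU kU
  have hl' : (lU : ZMod p) = (l : ZMod p) := ZMod.coe_unitOfCoprime l hl
  have hk' : (kU : ZMod p) = (k : ZMod p) := ZMod.coe_unitOfCoprime k hk
  have hkinv : ((kU⁻¹ : (ZMod p)ˣ) : ZMod p) = ((((k : ZMod p)⁻¹).val : ℕ) : ZMod p) := by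
    rw [← ZMod.inv_coe_unit, hk', ZMod.natCast_zmod_val]
  rw [hl', hk', hkinv] at h
  have hlhs : (ZMod.stdAddChar ((l : ZMod p) * ((((k : ZMod p)⁻¹).val : ℕ) : ZMod p)) : ℂ) =
      Complex.exp (2 * π * I * ((l : ℂ) * (((k : ZMod p)⁻¹).val : ℂ) / (p : ℂ))) := by
    have hcast : ((l : ZMod p) * ((((k : ZMod p)⁻¹).val : ℕ) : ZMod p)) =
        ((((l : ℤ) * ((((k : ZMod p)⁻¹).val : ℕ) : ℤ)) : ℤ) : ZMod p) := by push_cast; ring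
    rw [hcast, ZMod.stdAddChar_coe]
    congr 1
    push_cast
    ring
  rw [hlhs] at h
  have hsum : tauTwist D p l k = ∑ ψ ∈ (Finset.univ : Finset (DirichletCharacter ℂ p)).erase 1,
      gaussSum ψ⁻¹ (ZMod.stdAddChar (N := p)) * ψ (l : ZMod p) * ψ⁻¹ (k : ZMod p) := by
    refine sumPrimAt_eq_sum_erase hp _ _ ?_
    rintro ⟨p', mem, ψ, prim⟩ hx
    change p' = p at hx
    subst hx
    rfl
  rw [hsum]
  exact h

/-- For `p ∣ l` the character sum `Σ*_{ψ (mod p)} τ(ψ̄)ψ(l)ψ̄(k)` VANISHES (`ψ(l) = ψ(0) = 0`) — the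
reason the constraint `(l,p) = 1` appears in (7.7). [cite: Zhang2022LandauSiegel, §7 (7.7) p. 36, tex L1940] -/
theorem tauTwist_eq_zero_of_dvd {D p : ℕ} (hp : p ∈ Skeleton.primeWindow D) {l : ℕ} (hl : p ∣ l)
    (k : ℕ) : tauTwist D p l k = 0 := by
  classical
  have hprime : p.Prime := (Finset.mem_filter.mp hp).2
  haveI : Fact p.Prime := ⟨hprime⟩
  have hsum : tauTwist D p l k = ∑ ψ ∈ (Finset.univ : Finset (DirichletCharacter ℂ p)).erase 1,
      gaussSum ψ⁻¹ (ZMod.stdAddChar (N := p)) * ψ (l : ZMod p) * ψ⁻¹ (k : ZMod p) := by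
    refine sumPrimAt_eq_sum_erase hp _ _ ?_
    rintro ⟨p', mem, ψ, prim⟩ hx
    change p' = p at hx
    subst hx
    rfl
  rw [hsum]
  refine Finset.sum_eq_zero fun ψ _ => ?_
  have h0 : ((l : ℕ) : ZMod p) = 0 := (ZMod.natCast_eq_zero_iff l p).mpr hl
  rw [h0, ψ.map_nonunit not_isUnit_zero, mul_zero, zero_mul]

/-! ## `Z22:(7.7)` and tex L1944 reduced to explicit error sums -/

/-- `|e(l k̄/p)| = 1`. [cite: Zhang2022LandauSiegel, §2 p. 3] -/
theorem norm_exp_twist (p l kb : ℕ) :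
    ‖Complex.exp (2 * π * I * ((l : ℂ) * (kb : ℂ) / (p : ℂ)))‖ = 1 := by
  rw [show (2 * π * I * ((l : ℂ) * (kb : ℂ) / (p : ℂ)) : ℂ) =
      ((2 * π * ((l : ℝ) * kb / p) : ℝ) : ℂ) * I by push_cast; ring]
  exact Complex.norm_exp_ofReal_mul_I _

/-- Linearity of `∑'` in the shape used below (`q·ΣF = ΣG + q·ΣE` from `qF = G + qE` termwise,
`G`, `E` summable). [folklore] -/
private theorem mul_tsum_eq_tsum_add {F G E : ℕ → ℂ} (q : ℂ) (hG : Summable G) (hE : Summable E)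
    (h : ∀ l, q * F l = G l + q * E l) : q * ∑' l, F l = ∑' l, G l + q * ∑' l, E l := by
  rw [← tsum_mul_left, ← tsum_mul_left, ← hG.tsum_add (hE.mul_left q)]
  exact tsum_congr h

/-- **Inserting the exact `Z22:§7.u025` into the `u024`-form**: `rhs7u024 = rhs77 + p⁻¹·E₇₇` with the
EXPLICIT error sum `E₇₇ = Σ_d d⁻¹ Σ_{(l,p)=1} Σ_{(k,l)=1} (κ∗a₁)(dl)a₂(dk)k⁻¹(1 − e(lk̄/p))Δ₁(l/(pk))`
(the source's "`+O(1)`" of u025 is exactly `1 − e(lk̄/p)`; the terms with `p ∣ l` vanish, whence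
the constraint `(l,p) = 1` of (7.7)); the `l`-series converge absolutely by a (5.9)-type bound.
[cite: Zhang2022LandauSiegel, §7 (7.7) p. 36, tex L1935–L1942] -/
theorem rhs7u024_eq_rhs77_add (c' : ℝ) {D p : ℕ} (hp : p ∈ Skeleton.primeWindow D)
    {a₁ a₂ : ℕ → ℂ} {B : ℝ} (ha₁ : ∀ n, ‖a₁ n‖ ≤ B) {C a b T : ℝ} (ha : 0 < a) (hb : 0 < b)
    (hΔ : ∀ x : ℝ, T < x → ‖Skeleton.DeltaW D x‖ ≤
      C * (Real.exp (-(a * Real.log x) ^ 2) + Real.exp (-(x ^ (0.99 : ℝ)) / b))) :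
    rhs7u024 c' D p a₁ a₂ = rhs77 c' D p a₁ a₂ + 1 / (p : ℂ) *
      ∑ d ∈ Finset.Ico 1 (Skeleton.Nsupp D), 1 / (d : ℂ) *
        ∑' l : ℕ, ∑ k ∈ (Finset.Ico 1 (Skeleton.Nsupp D)).filter (fun k => Nat.Coprime k l),
          if Nat.Coprime l p then
            kappaConv c' D a₁ (d * l) * a₂ (d * k) / (k : ℂ) *
              (1 - Complex.exp (2 * π * I * ((l : ℂ) * (((k : ZMod p)⁻¹).val : ℂ) / (p : ℂ)))) *
              Iface.Delta1W D ((l : ℝ) / ((p : ℝ) * k))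
          else 0 := by
  classical
  have hprime : p.Prime := (Finset.mem_filter.mp hp).2
  haveI : Fact p.Prime := ⟨hprime⟩
  have hp0 : 0 < p := hprime.pos
  have hpC : (p : ℂ) ≠ 0 := by exact_mod_cast hprime.ne_zero
  have hΔ1 : ∀ x : ℝ, T < x → ‖Iface.Delta1W D x‖ ≤
      C * (Real.exp (-(a * Real.log x) ^ 2) + Real.exp (-(x ^ (0.99 : ℝ)) / b)) := by
    intro x hx; rw [norm_Delta1W_eq]; exact hΔ x hx
  set Ik := Finset.Ico 1 (Skeleton.Nsupp D) with hIk
  have hkp : ∀ k ∈ Ik, k < p := fun k hk => lt_of_mem_Ico_Nsupp hk hp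
  -- pointwise identity
  have hpt : ∀ d l : ℕ, ∀ k ∈ Ik.filter (fun k => Nat.Coprime k l),
      1 / (p : ℂ) * (kappaConv c' D a₁ (d * l) * a₂ (d * k) / (k : ℂ) * tauTwist D p l k *
          Iface.Delta1W D ((l : ℝ) / ((p : ℝ) * k))) =
        (if Nat.Coprime l p then
            kappaConv c' D a₁ (d * l) * a₂ (d * k) / (k : ℂ) *
              Complex.exp (2 * π * I * ((l : ℂ) * (((k : ZMod p)⁻¹).val : ℂ) / (p : ℂ))) *
              Iface.Delta1W D ((l : ℝ) / ((p : ℝ) * k))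
          else 0) +
        1 / (p : ℂ) * (if Nat.Coprime l p then
            kappaConv c' D a₁ (d * l) * a₂ (d * k) / (k : ℂ) *
              (1 - Complex.exp (2 * π * I * ((l : ℂ) * (((k : ZMod p)⁻¹).val : ℂ) / (p : ℂ)))) *
              Iface.Delta1W D ((l : ℝ) / ((p : ℝ) * k))
          else 0) := by
    intro d l k hk
    obtain ⟨hkI, hkl⟩ := Finset.mem_filter.mp hk
    have hk1 : 0 < k := by rw [hIk, Finset.mem_Ico] at hkI; omega
    by_cases hlp : Nat.Coprime l p
    · have hkp' : Nat.Coprime k p := (Nat.coprime_of_lt_prime (by omega) (hkp k hkI) hprime).symm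
      have hklp : Nat.Coprime (k * l) p := Nat.Coprime.mul_left hkp' hlp
      rw [tauTwist_eq hp hklp, if_pos hlp, if_pos hlp]
      field_simp
      ring
    · have hdvd : p ∣ l := by
        by_contra h
        exact hlp ((Nat.Prime.coprime_iff_not_dvd hprime).mpr h).symm
      rw [tauTwist_eq_zero_of_dvd hp hdvd, if_neg hlp, if_neg hlp]
      simp
  -- summability of the two `l`-series
  have hSG : ∀ d : ℕ, Summable (fun l : ℕ => ∑ k ∈ Ik.filter (fun k => Nat.Coprime k l),
      if Nat.Coprime l p then
        kappaConv c' D a₁ (d * l) * a₂ (d * k) / (k : ℂ) *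
          Complex.exp (2 * π * I * ((l : ℂ) * (((k : ZMod p)⁻¹).val : ℂ) / (p : ℂ))) *
          Iface.Delta1W D ((l : ℝ) / ((p : ℝ) * k))
      else 0) := by
    intro d
    have hfun : (fun l : ℕ => ∑ k ∈ Ik.filter (fun k => Nat.Coprime k l),
        if Nat.Coprime l p then
          kappaConv c' D a₁ (d * l) * a₂ (d * k) / (k : ℂ) *
            Complex.exp (2 * π * I * ((l : ℂ) * (((k : ZMod p)⁻¹).val : ℂ) / (p : ℂ))) *
            Iface.Delta1W D ((l : ℝ) / ((p : ℝ) * k))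
        else 0) = fun l : ℕ => ∑ k ∈ Ik, if Nat.Coprime k l then (if Nat.Coprime l p then
          kappaConv c' D a₁ (d * l) * a₂ (d * k) / (k : ℂ) *
            Complex.exp (2 * π * I * ((l : ℂ) * (((k : ZMod p)⁻¹).val : ℂ) / (p : ℂ))) *
            Iface.Delta1W D ((l : ℝ) / ((p : ℝ) * k))
        else 0) else 0 := by
      funext l; rw [Finset.sum_filter]
    rw [hfun]
    refine summable_sum fun k hk => ?_
    have hk1 : 0 < k := by rw [hIk, Finset.mem_Ico] at hk; omega
    have hbase := summable_kappaConv_mul_of_decay (D := D) (Φ := Iface.Delta1W D) ha hb hΔ1 c'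
      ha₁ d hp0 hk1
      (fun l => a₂ (d * k) / (k : ℂ) *
        Complex.exp (2 * π * I * ((l : ℂ) * (((k : ZMod p)⁻¹).val : ℂ) / (p : ℂ))))
      (G := ‖a₂ (d * k) / (k : ℂ)‖)
      (fun l => by rw [norm_mul, norm_exp_twist, mul_one])
    refine Summable.of_norm_bounded hbase.norm fun l => ?_
    split_ifs with h1 h2
    · apply le_of_eq; congr 1; ring
    · rw [norm_zero]; exact norm_nonneg _
    · rw [norm_zero]; exact norm_nonneg _
  have hSE : ∀ d : ℕ, Summable (fun l : ℕ => ∑ k ∈ Ik.filter (fun k => Nat.Coprime k l),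
      if Nat.Coprime l p then
        kappaConv c' D a₁ (d * l) * a₂ (d * k) / (k : ℂ) *
          (1 - Complex.exp (2 * π * I * ((l : ℂ) * (((k : ZMod p)⁻¹).val : ℂ) / (p : ℂ)))) *
          Iface.Delta1W D ((l : ℝ) / ((p : ℝ) * k))
      else 0) := by
    intro d
    have hfun : (fun l : ℕ => ∑ k ∈ Ik.filter (fun k => Nat.Coprime k l),
        if Nat.Coprime l p then
          kappaConv c' D a₁ (d * l) * a₂ (d * k) / (k : ℂ) *
            (1 - Complex.exp (2 * π * I * ((l : ℂ) * (((k : ZMod p)⁻¹).val : ℂ) / (p : ℂ)))) *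
            Iface.Delta1W D ((l : ℝ) / ((p : ℝ) * k))
        else 0) = fun l : ℕ => ∑ k ∈ Ik, if Nat.Coprime k l then (if Nat.Coprime l p then
          kappaConv c' D a₁ (d * l) * a₂ (d * k) / (k : ℂ) *
            (1 - Complex.exp (2 * π * I * ((l : ℂ) * (((k : ZMod p)⁻¹).val : ℂ) / (p : ℂ)))) *
            Iface.Delta1W D ((l : ℝ) / ((p : ℝ) * k))
        else 0) else 0 := by
      funext l; rw [Finset.sum_filter]
    rw [hfun]
    refine summable_sum fun k hk => ?_
    have hk1 : 0 < k := by rw [hIk, Finset.mem_Ico] at hk; omega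
    have hbase := summable_kappaConv_mul_of_decay (D := D) (Φ := Iface.Delta1W D) ha hb hΔ1 c'
      ha₁ d hp0 hk1
      (fun l => a₂ (d * k) / (k : ℂ) *
        (1 - Complex.exp (2 * π * I * ((l : ℂ) * (((k : ZMod p)⁻¹).val : ℂ) / (p : ℂ)))))
      (G := ‖a₂ (d * k) / (k : ℂ)‖ * 2)
      (fun l => by
        rw [norm_mul]
        refine mul_le_mul_of_nonneg_left ?_ (norm_nonneg _)
        calc ‖(1 : ℂ) - Complex.exp (2 * π * I * ((l : ℂ) * (((k : ZMod p)⁻¹).val : ℂ) / (p : ℂ)))‖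
            ≤ ‖(1 : ℂ)‖ + ‖Complex.exp (2 * π * I * ((l : ℂ) * (((k : ZMod p)⁻¹).val : ℂ) / (p : ℂ)))‖ :=
              norm_sub_le _ _
          _ = 2 := by rw [norm_exp_twist, norm_one]; norm_num)
    refine Summable.of_norm_bounded hbase.norm fun l => ?_
    split_ifs with h1 h2
    · apply le_of_eq; congr 1; ring
    · rw [norm_zero]; exact norm_nonneg _
    · rw [norm_zero]; exact norm_nonneg _
  -- assemble
  unfold rhs7u024 rhs77
  simp only [← hIk]
  rw [Finset.mul_sum, Finset.mul_sum, ← Finset.sum_add_distrib]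
  refine Finset.sum_congr rfl fun d _ => ?_
  have key : 1 / (p : ℂ) * ∑' l : ℕ, (∑ k ∈ Ik.filter (fun k => Nat.Coprime k l),
      kappaConv c' D a₁ (d * l) * a₂ (d * k) / (k : ℂ) * tauTwist D p l k *
        Iface.Delta1W D ((l : ℝ) / ((p : ℝ) * k))) =
      ∑' l : ℕ, (∑ k ∈ Ik.filter (fun k => Nat.Coprime k l),
        if Nat.Coprime l p then
          kappaConv c' D a₁ (d * l) * a₂ (d * k) / (k : ℂ) *
            Complex.exp (2 * π * I * ((l : ℂ) * (((k : ZMod p)⁻¹).val : ℂ) / (p : ℂ))) *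
            Iface.Delta1W D ((l : ℝ) / ((p : ℝ) * k))
        else 0) +
      1 / (p : ℂ) * ∑' l : ℕ, (∑ k ∈ Ik.filter (fun k => Nat.Coprime k l),
        if Nat.Coprime l p then
          kappaConv c' D a₁ (d * l) * a₂ (d * k) / (k : ℂ) *
            (1 - Complex.exp (2 * π * I * ((l : ℂ) * (((k : ZMod p)⁻¹).val : ℂ) / (p : ℂ)))) *
            Iface.Delta1W D ((l : ℝ) / ((p : ℝ) * k))
        else 0) :=
    mul_tsum_eq_tsum_add _ (hSG d) (hSE d) (fun l => by
      rw [Finset.mul_sum, Finset.mul_sum, ← Finset.sum_add_distrib]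
      exact Finset.sum_congr rfl fun k hk => hpt d l k hk)
  rw [mul_left_comm (1 / (p : ℂ)) (1 / (d : ℂ)), key, mul_add,
    mul_left_comm (1 / (d : ℂ)) (1 / (p : ℂ))]

/-- **Removing the constraint `(l,p) = 1`**: `rhs77all = rhs77 + F₇₇` with the EXPLICIT sum
`F₇₇ = Σ_d d⁻¹ Σ_{p ∣ l} Σ_{(k,l)=1} (κ∗a₁)(dl)a₂(dk)k⁻¹e(lk̄/p)Δ₁(l/(pk))` of the terms with
`p ∣ l` (to be shown `O(PT⁻ᶜ)` "by trivial estimation", tex L1944); the `l`-series converge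
absolutely by a (5.9)-type bound. [cite: Zhang2022LandauSiegel, §7 p. 36, tex L1944] -/
theorem rhs77all_eq_rhs77_add (c' : ℝ) {D p : ℕ} (hp : p ∈ Skeleton.primeWindow D)
    {a₁ a₂ : ℕ → ℂ} {B : ℝ} (ha₁ : ∀ n, ‖a₁ n‖ ≤ B) {C a b T : ℝ} (ha : 0 < a) (hb : 0 < b)
    (hΔ : ∀ x : ℝ, T < x → ‖Skeleton.DeltaW D x‖ ≤
      C * (Real.exp (-(a * Real.log x) ^ 2) + Real.exp (-(x ^ (0.99 : ℝ)) / b))) :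
    rhs77all c' D p a₁ a₂ = rhs77 c' D p a₁ a₂ +
      ∑ d ∈ Finset.Ico 1 (Skeleton.Nsupp D), 1 / (d : ℂ) *
        ∑' l : ℕ, ∑ k ∈ (Finset.Ico 1 (Skeleton.Nsupp D)).filter (fun k => Nat.Coprime k l),
          if Nat.Coprime l p then 0 else
            kappaConv c' D a₁ (d * l) * a₂ (d * k) / (k : ℂ) *
              Complex.exp (2 * π * I * ((l : ℂ) * (((k : ZMod p)⁻¹).val : ℂ) / (p : ℂ))) *
              Iface.Delta1W D ((l : ℝ) / ((p : ℝ) * k)) := by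
  classical
  have hprime : p.Prime := (Finset.mem_filter.mp hp).2
  have hp0 : 0 < p := hprime.pos
  have hΔ1 : ∀ x : ℝ, T < x → ‖Iface.Delta1W D x‖ ≤
      C * (Real.exp (-(a * Real.log x) ^ 2) + Real.exp (-(x ^ (0.99 : ℝ)) / b)) := by
    intro x hx; rw [norm_Delta1W_eq]; exact hΔ x hx
  set Ik := Finset.Ico 1 (Skeleton.Nsupp D) with hIk
  -- summability of the generic piece `l ↦ Σ_k [cop k l] (if P l then X else 0)` for any predicate
  have hS : ∀ d : ℕ, ∀ P : ℕ → Prop, ∀ [DecidablePred P],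
      Summable (fun l : ℕ => ∑ k ∈ Ik.filter (fun k => Nat.Coprime k l),
        if P l then
          kappaConv c' D a₁ (d * l) * a₂ (d * k) / (k : ℂ) *
            Complex.exp (2 * π * I * ((l : ℂ) * (((k : ZMod p)⁻¹).val : ℂ) / (p : ℂ))) *
            Iface.Delta1W D ((l : ℝ) / ((p : ℝ) * k))
        else 0) := by
    intro d P _
    have hfun : (fun l : ℕ => ∑ k ∈ Ik.filter (fun k => Nat.Coprime k l),
        if P l then
          kappaConv c' D a₁ (d * l) * a₂ (d * k) / (k : ℂ) *
            Complex.exp (2 * π * I * ((l : ℂ) * (((k : ZMod p)⁻¹).val : ℂ) / (p : ℂ))) *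
            Iface.Delta1W D ((l : ℝ) / ((p : ℝ) * k))
        else 0) = fun l : ℕ => ∑ k ∈ Ik, if Nat.Coprime k l then (if P l then
          kappaConv c' D a₁ (d * l) * a₂ (d * k) / (k : ℂ) *
            Complex.exp (2 * π * I * ((l : ℂ) * (((k : ZMod p)⁻¹).val : ℂ) / (p : ℂ))) *
            Iface.Delta1W D ((l : ℝ) / ((p : ℝ) * k))
        else 0) else 0 := by
      funext l; rw [Finset.sum_filter]
    rw [hfun]
    refine summable_sum fun k hk => ?_
    have hk1 : 0 < k := by rw [hIk, Finset.mem_Ico] at hk; omega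
    have hbase := summable_kappaConv_mul_of_decay (D := D) (Φ := Iface.Delta1W D) ha hb hΔ1 c'
      ha₁ d hp0 hk1
      (fun l => a₂ (d * k) / (k : ℂ) *
        Complex.exp (2 * π * I * ((l : ℂ) * (((k : ZMod p)⁻¹).val : ℂ) / (p : ℂ))))
      (G := ‖a₂ (d * k) / (k : ℂ)‖)
      (fun l => by rw [norm_mul, norm_exp_twist, mul_one])
    refine Summable.of_norm_bounded hbase.norm fun l => ?_
    split_ifs with h1 h2
    · apply le_of_eq; congr 1; ring
    · rw [norm_zero]; exact norm_nonneg _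
    · rw [norm_zero]; exact norm_nonneg _
  have hSall := fun d => hS d (fun _ => True)
  have hSG := fun d => hS d (fun l => Nat.Coprime l p)
  have hSF := fun d => hS d (fun l => ¬Nat.Coprime l p)
  unfold rhs77all rhs77
  rw [← Finset.sum_add_distrib]
  refine Finset.sum_congr rfl fun d _ => ?_
  rw [← mul_add]
  congr 1
  have hF' : (fun l : ℕ => ∑ k ∈ Ik.filter (fun k => Nat.Coprime k l),
      if Nat.Coprime l p then 0 else
        kappaConv c' D a₁ (d * l) * a₂ (d * k) / (k : ℂ) *
          Complex.exp (2 * π * I * ((l : ℂ) * (((k : ZMod p)⁻¹).val : ℂ) / (p : ℂ))) *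
          Iface.Delta1W D ((l : ℝ) / ((p : ℝ) * k))) =
      fun l : ℕ => ∑ k ∈ Ik.filter (fun k => Nat.Coprime k l),
        if ¬Nat.Coprime l p then
          kappaConv c' D a₁ (d * l) * a₂ (d * k) / (k : ℂ) *
            Complex.exp (2 * π * I * ((l : ℂ) * (((k : ZMod p)⁻¹).val : ℂ) / (p : ℂ))) *
            Iface.Delta1W D ((l : ℝ) / ((p : ℝ) * k))
        else 0 := by
    funext l; refine Finset.sum_congr rfl fun k _ => ?_; split_ifs <;> simp_all
  rw [hF', ← (hSG d).tsum_add (hSF d)]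
  refine tsum_congr fun l => ?_
  rw [← Finset.sum_add_distrib]
  refine Finset.sum_congr rfl fun k _ => ?_
  split_ifs <;> simp

/-- `e^{−c₁𝓛¹⁰} ≤ P·T^{−c}` for `0 ≤ c ≤ c₁`, `𝓛 ≥ 1` (`P = e^{𝓛⁹}`, `T = e^{𝓛^{1.1}}`): an
exponentially small error is `O(PT⁻ᶜ)`. [cite: Zhang2022LandauSiegel, §2 p. 4] -/
theorem exp_neg_ell_ten_le_bigP_mul_bigT_rpow {D : ℕ} {c₁ c : ℝ} (hc : 0 ≤ c) (hcc : c ≤ c₁)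
    (hL : 1 ≤ Skeleton.ell D) :
    Real.exp (-c₁ * Skeleton.ell D ^ 10) ≤ Skeleton.bigP D * Skeleton.bigT D ^ (-c) := by
  rw [Skeleton.bigP, Skeleton.bigT, ← Real.exp_mul, ← Real.exp_add, Real.exp_le_exp]
  have hL0 : 0 ≤ Skeleton.ell D := by linarith
  have h1 : Skeleton.ell D ^ (1.1 : ℝ) ≤ Skeleton.ell D ^ 10 := by
    calc Skeleton.ell D ^ (1.1 : ℝ) ≤ Skeleton.ell D ^ ((10 : ℕ) : ℝ) :=
          Real.rpow_le_rpow_of_exponent_le hL (by norm_num)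
      _ = Skeleton.ell D ^ 10 := Real.rpow_natCast _ 10
  have h9 : 0 ≤ Skeleton.ell D ^ 9 := by positivity
  have h10 : 0 ≤ Skeleton.ell D ^ 10 := by positivity
  have h11 : 0 ≤ Skeleton.ell D ^ (1.1 : ℝ) := Real.rpow_nonneg hL0 _
  nlinarith [mul_le_mul_of_nonneg_left h1 hc, mul_le_mul_of_nonneg_right hcc h10]

/-- `T^{−c₂} ≤ T^{−c}` for `c ≤ c₂` (`T ≥ 1`). [cite: Zhang2022LandauSiegel, §2 p. 4] -/
theorem bigT_rpow_neg_le {D : ℕ} {c₂ c : ℝ} (hcc : c ≤ c₂) :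
    Skeleton.bigT D ^ (-c₂) ≤ Skeleton.bigT D ^ (-c) :=
  Real.rpow_le_rpow_of_exponent_le (one_le_bigT D) (by linarith)

/-- **Kernel edge `§7.u022 ∧ (p⁻¹E₇₇ = O(PT⁻ᶜ)) ⇒ Z22:(7.7)`**: "Hence, by Lemma 5.4, [(7.7)]" — with
u023, u024 and the exact u025 in the kernel, (7.7) holds as soon as the EXPLICIT error sum
`p⁻¹E₇₇ = p⁻¹Σ_d d⁻¹Σ_{(l,p)=1}Σ_{(k,l)=1}(κ∗a₁)(dl)a₂(dk)k⁻¹(1 − e(lk̄/p))Δ₁(l/(pk))` is `O(PT⁻ᶜ)`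
(the estimate the source assigns to Lemma 5.4; hypothesis `hE`, unprinted in this form); the
`O(ε) = O(e^{−c𝓛¹⁰})` of u022–u024 is absorbed since `e^{−c₁𝓛¹⁰} ≤ PT^{−c}` for `c ≤ c₁`.
[cite: Zhang2022LandauSiegel, §7 (7.7) p. 36, tex L1935–L1942] -/
theorem eq77_of (c' : ℝ) (h22 : Step7u022 c')
    (hE : ∀ B : ℝ, ∃ c : ℝ, 0 < c ∧ ∃ C : ℝ, Skeleton.ForAllLarge fun D _ χ =>
      Skeleton.AssumptionA D χ → ∀ a₁ a₂ : ℕ → ℂ, Skeleton.Adm72 D B a₁ → Skeleton.Adm72 D B a₂ →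
        ∀ p ∈ Skeleton.primeWindow D,
          ‖1 / (p : ℂ) * ∑ d ∈ Finset.Ico 1 (Skeleton.Nsupp D), 1 / (d : ℂ) *
              ∑' l : ℕ, ∑ k ∈ (Finset.Ico 1 (Skeleton.Nsupp D)).filter (fun k => Nat.Coprime k l),
                if Nat.Coprime l p then
                  kappaConv c' D a₁ (d * l) * a₂ (d * k) / (k : ℂ) *
                    (1 - Complex.exp (2 * π * I *
                      ((l : ℂ) * (((k : ZMod p)⁻¹).val : ℂ) / (p : ℂ)))) *
                    Iface.Delta1W D ((l : ℝ) / ((p : ℝ) * k))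
                else 0‖ ≤ C * Skeleton.bigP D * Skeleton.bigT D ^ (-c)) :
    Eq77 c' := by
  intro B
  obtain ⟨c₁, hc₁, C₁, h₁⟩ := sumPrimAt_I1psi_sub_rhs7u024' c' h22 B
  obtain ⟨c₂, hc₂, C₂, h₂⟩ := hE B
  obtain ⟨c5, -, C5, h53'⟩ := Skeleton.lemma53_holds
  refine ⟨min c₁ c₂, lt_min hc₁ hc₂, |C₁| + |C₂|, ?_⟩
  have hall := (h₁.and h₂).and (h53'.and
    (Skeleton.ForAllLarge.of_le (S := fun D _ _ => 3 ≤ D) 3 (fun D _ _ hD _ _ => hD)))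
  refine hall.mono fun D _ χ _ _ hDall hA a₁ a₂ ha₁ ha₂ p hp => ?_
  obtain ⟨⟨hD1, hD2⟩, hA53, hD3⟩ := hDall
  have hD1' : (1 : ℝ) < D := by exact_mod_cast (show 1 < D by omega)
  have hL0 : 0 < Skeleton.ell D := by rw [Skeleton.ell]; exact Real.log_pos hD1'
  have hL1 : 1 ≤ Skeleton.ell D := by
    rw [Skeleton.ell, Real.le_log_iff_exp_le (by positivity)]
    calc Real.exp 1 ≤ 3 := by have := Real.exp_one_lt_d9; norm_num at this ⊢; linarith
      _ ≤ (D : ℝ) := by exact_mod_cast hD3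
  have hL2' : 0 < Skeleton.ell2 D := by rw [Skeleton.ell2]; positivity
  have ht0 : 0 ≤ Skeleton.t0 D ^ (1.02 : ℝ) :=
    Real.rpow_nonneg (by rw [Skeleton.t0]; positivity) _
  have hΔ : ∀ x : ℝ, Skeleton.t0 D ^ (1.02 : ℝ) < x → ‖Skeleton.DeltaW D x‖ ≤
      C5 * (Real.exp (-((1 : ℝ) / 100 * Skeleton.ell2 D * Real.log x) ^ 2) +
        Real.exp (-(x ^ (0.99 : ℝ)) / Skeleton.ell2 D)) :=
    fun x hx => (hA53 x (lt_of_le_of_lt ht0 hx)).2 hx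
  have hid := rhs7u024_eq_rhs77_add c' hp (a₂ := a₂) ha₁.1 (a := (1 : ℝ) / 100 * Skeleton.ell2 D)
    (by positivity) hL2' hΔ
  have e1 := hD1 hA a₁ a₂ ha₁ ha₂ p hp
  obtain ⟨X, hX, hid'⟩ : ∃ X : ℂ, ‖X‖ ≤ C₂ * Skeleton.bigP D * Skeleton.bigT D ^ (-c₂) ∧
      rhs7u024 c' D p a₁ a₂ = rhs77 c' D p a₁ a₂ + X := ⟨_, hD2 hA a₁ a₂ ha₁ ha₂ p hp, hid⟩
  set S := sumPrimAt D p (fun x => I1psi c' x a₁ a₂) with hS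
  have hP0 : 0 ≤ Skeleton.bigP D := (Real.exp_pos _).le
  have hT0 : ∀ y : ℝ, 0 ≤ Skeleton.bigT D ^ y := fun y => Real.rpow_nonneg (Real.exp_pos _).le _
  have b1 : Real.exp (-c₁ * Skeleton.ell D ^ 10) ≤
      Skeleton.bigP D * Skeleton.bigT D ^ (-min c₁ c₂) :=
    exp_neg_ell_ten_le_bigP_mul_bigT_rpow (le_of_lt (lt_min hc₁ hc₂)) (min_le_left _ _) hL1
  have b2 : Skeleton.bigP D * Skeleton.bigT D ^ (-c₂) ≤
      Skeleton.bigP D * Skeleton.bigT D ^ (-min c₁ c₂) :=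
    mul_le_mul_of_nonneg_left (bigT_rpow_neg_le (min_le_right _ _)) hP0
  have hrw : S - rhs77 c' D p a₁ a₂ = (S - rhs7u024 c' D p a₁ a₂) + X := by rw [hid']; ring
  rw [hrw]
  calc ‖S - rhs7u024 c' D p a₁ a₂ + X‖ ≤ ‖S - rhs7u024 c' D p a₁ a₂‖ + ‖X‖ := norm_add_le _ _
    _ ≤ C₁ * Real.exp (-c₁ * Skeleton.ell D ^ 10) +
          C₂ * Skeleton.bigP D * Skeleton.bigT D ^ (-c₂) := add_le_add e1 hX
    _ ≤ |C₁| * Real.exp (-c₁ * Skeleton.ell D ^ 10) +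
          |C₂| * (Skeleton.bigP D * Skeleton.bigT D ^ (-c₂)) := by
        rw [mul_assoc]
        exact add_le_add (mul_le_mul_of_nonneg_right (le_abs_self C₁) (Real.exp_pos _).le)
          (mul_le_mul_of_nonneg_right (le_abs_self C₂) (mul_nonneg hP0 (hT0 _)))
    _ ≤ |C₁| * (Skeleton.bigP D * Skeleton.bigT D ^ (-min c₁ c₂)) +
          |C₂| * (Skeleton.bigP D * Skeleton.bigT D ^ (-min c₁ c₂)) :=
        add_le_add (mul_le_mul_of_nonneg_left b1 (abs_nonneg _))
          (mul_le_mul_of_nonneg_left b2 (abs_nonneg _))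
    _ = (|C₁| + |C₂|) * Skeleton.bigP D * Skeleton.bigT D ^ (-min c₁ c₂) := by ring

/-- **Kernel edge `(7.7) ∧ (F₇₇ = O(PT⁻ᶜ)) ⇒ (7.7)′`** ("By trivial estimation, this remains valid if
the constraint `(l,p) = 1` is removed", tex L1944): with `rhs77all = rhs77 + F₇₇`
(`rhs77all_eq_rhs77_add`), the sentence holds as soon as the EXPLICIT sum `F₇₇` of the `p ∣ l`
terms is `O(PT⁻ᶜ)` (hypothesis `hF` — the "trivial estimation", unprinted).
[cite: Zhang2022LandauSiegel, §7 p. 36, tex L1944] -/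
theorem step7t1944_of (c' : ℝ) (h77 : Eq77 c')
    (hF : ∀ B : ℝ, ∃ c : ℝ, 0 < c ∧ ∃ C : ℝ, Skeleton.ForAllLarge fun D _ χ =>
      Skeleton.AssumptionA D χ → ∀ a₁ a₂ : ℕ → ℂ, Skeleton.Adm72 D B a₁ → Skeleton.Adm72 D B a₂ →
        ∀ p ∈ Skeleton.primeWindow D,
          ‖∑ d ∈ Finset.Ico 1 (Skeleton.Nsupp D), 1 / (d : ℂ) *
              ∑' l : ℕ, ∑ k ∈ (Finset.Ico 1 (Skeleton.Nsupp D)).filter (fun k => Nat.Coprime k l),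
                if Nat.Coprime l p then 0 else
                  kappaConv c' D a₁ (d * l) * a₂ (d * k) / (k : ℂ) *
                    Complex.exp (2 * π * I * ((l : ℂ) * (((k : ZMod p)⁻¹).val : ℂ) / (p : ℂ))) *
                    Iface.Delta1W D ((l : ℝ) / ((p : ℝ) * k))‖
            ≤ C * Skeleton.bigP D * Skeleton.bigT D ^ (-c)) :
    Step7t1944 c' := by
  intro B
  obtain ⟨c₁, hc₁, C₁, h₁⟩ := h77 B
  obtain ⟨c₂, hc₂, C₂, h₂⟩ := hF B
  obtain ⟨c5, -, C5, h53'⟩ := Skeleton.lemma53_holds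
  refine ⟨min c₁ c₂, lt_min hc₁ hc₂, |C₁| + |C₂|, ?_⟩
  have hall := (h₁.and h₂).and (h53'.and
    (Skeleton.ForAllLarge.of_le (S := fun D _ _ => 3 ≤ D) 3 (fun D _ _ hD _ _ => hD)))
  refine hall.mono fun D _ χ _ _ hDall hA a₁ a₂ ha₁ ha₂ p hp => ?_
  obtain ⟨⟨hD1, hD2⟩, hA53, hD3⟩ := hDall
  have hD1' : (1 : ℝ) < D := by exact_mod_cast (show 1 < D by omega)
  have hL0 : 0 < Skeleton.ell D := by rw [Skeleton.ell]; exact Real.log_pos hD1'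
  have hL2' : 0 < Skeleton.ell2 D := by rw [Skeleton.ell2]; positivity
  have ht0 : 0 ≤ Skeleton.t0 D ^ (1.02 : ℝ) :=
    Real.rpow_nonneg (by rw [Skeleton.t0]; positivity) _
  have hΔ : ∀ x : ℝ, Skeleton.t0 D ^ (1.02 : ℝ) < x → ‖Skeleton.DeltaW D x‖ ≤
      C5 * (Real.exp (-((1 : ℝ) / 100 * Skeleton.ell2 D * Real.log x) ^ 2) +
        Real.exp (-(x ^ (0.99 : ℝ)) / Skeleton.ell2 D)) :=
    fun x hx => (hA53 x (lt_of_le_of_lt ht0 hx)).2 hx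
  have hid := rhs77all_eq_rhs77_add c' hp (a₂ := a₂) ha₁.1 (a := (1 : ℝ) / 100 * Skeleton.ell2 D)
    (by positivity) hL2' hΔ
  have e1 := hD1 hA a₁ a₂ ha₁ ha₂ p hp
  obtain ⟨Y, hY, hid'⟩ : ∃ Y : ℂ, ‖Y‖ ≤ C₂ * Skeleton.bigP D * Skeleton.bigT D ^ (-c₂) ∧
      rhs77all c' D p a₁ a₂ = rhs77 c' D p a₁ a₂ + Y := ⟨_, hD2 hA a₁ a₂ ha₁ ha₂ p hp, hid⟩
  set S := sumPrimAt D p (fun x => I1psi c' x a₁ a₂) with hS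
  have hP0 : 0 ≤ Skeleton.bigP D := (Real.exp_pos _).le
  have hT0 : ∀ y : ℝ, 0 ≤ Skeleton.bigT D ^ y := fun y => Real.rpow_nonneg (Real.exp_pos _).le _
  have b1 : Skeleton.bigP D * Skeleton.bigT D ^ (-c₁) ≤
      Skeleton.bigP D * Skeleton.bigT D ^ (-min c₁ c₂) :=
    mul_le_mul_of_nonneg_left (bigT_rpow_neg_le (min_le_left _ _)) hP0
  have b2 : Skeleton.bigP D * Skeleton.bigT D ^ (-c₂) ≤
      Skeleton.bigP D * Skeleton.bigT D ^ (-min c₁ c₂) :=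
    mul_le_mul_of_nonneg_left (bigT_rpow_neg_le (min_le_right _ _)) hP0
  have hrw : S - rhs77all c' D p a₁ a₂ = (S - rhs77 c' D p a₁ a₂) - Y := by rw [hid']; ring
  rw [hrw]
  calc ‖S - rhs77 c' D p a₁ a₂ - Y‖ ≤ ‖S - rhs77 c' D p a₁ a₂‖ + ‖Y‖ := norm_sub_le _ _
    _ ≤ C₁ * Skeleton.bigP D * Skeleton.bigT D ^ (-c₁) +
          C₂ * Skeleton.bigP D * Skeleton.bigT D ^ (-c₂) := add_le_add e1 hY
    _ ≤ |C₁| * (Skeleton.bigP D * Skeleton.bigT D ^ (-c₁)) +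
          |C₂| * (Skeleton.bigP D * Skeleton.bigT D ^ (-c₂)) := by
        rw [mul_assoc, mul_assoc]
        exact add_le_add (mul_le_mul_of_nonneg_right (le_abs_self C₁) (mul_nonneg hP0 (hT0 _)))
          (mul_le_mul_of_nonneg_right (le_abs_self C₂) (mul_nonneg hP0 (hT0 _)))
    _ ≤ |C₁| * (Skeleton.bigP D * Skeleton.bigT D ^ (-min c₁ c₂)) +
          |C₂| * (Skeleton.bigP D * Skeleton.bigT D ^ (-min c₁ c₂)) :=
        add_le_add (mul_le_mul_of_nonneg_left b1 (abs_nonneg _))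
          (mul_le_mul_of_nonneg_left b2 (abs_nonneg _))
    _ = (|C₁| + |C₂|) * Skeleton.bigP D * Skeleton.bigT D ^ (-min c₁ c₂) := by ring

end Literature.NumberTheory.LFunctions.Zhang2022.Section7bStatements
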